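import Literature.Probability.LatticeModels.MeanFieldDifferentialInequality
import Literature.Probability.LatticeModels.AizenmanGrahamInequality
import HarnessLib

/-!
# Proof of the Aizenman–Graham inequality (finite volume): discharge of `aizenmanGraham_inequality`

Topic `Probability/LatticeModels`, namespace `Literature.Probability.LatticeModels`. For the
ferromagnetic nearest-neighbour Ising model (coupling `β ≥ 0` on every edge of a locally finite
graph `G`) in a finite volume `Λ` with free boundary condition and zero field, writing
`⟨·⟩ = ⟨·⟩^∅_{Λ;β,0}`, `⟨xy⟩ = ⟨σ_xσ_y⟩`, and
`U₄(x₁,x₂,x₃,x₄) = ⟨σ₁σ₂σ₃σ₄⟩ - ⟨12⟩⟨34⟩ - ⟨13⟩⟨24⟩ - ⟨14⟩⟨23⟩` for the Ursell function, we prove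
the **Aizenman–Graham inequality** (Aizenman–Graham 1983; as printed in Tasaki–Hara 2015,
Theorem A.18, eq. (A.125), for couplings `J_{u,v} = 1_{u ∼ v}`):

`U₄(x₁,x₂,x₃,x₄) ≥ - tanh β ∑_{u,v ∈ Λ, u ∼ v} ⟨σ₁σ_v⟩⟨σ₂σ_v⟩ ⟨σ_uσ_v ; σ₃σ₄⟩`
`                  - ⟨13⟩⟨23⟩⟨43⟩ - ⟨14⟩⟨24⟩⟨34⟩`

(`aizenmanGraham_inequality_isingCorr`, and, in the spelling of the tree's named fact of
`AizenmanGrahamInequality.lean` with `isingPairCov`/`isingUrsellFour`, its DISCHARGE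
`aizenmanGraham_inequality_holds : aizenmanGraham_inequality G Λ β`), where
`⟨σ_uσ_v ; σ₃σ₄⟩ = ⟨σ_uσ_vσ₃σ₄⟩ - ⟨σ_uσ_v⟩⟨σ₃σ₄⟩` and the sum runs over ordered adjacent pairs of `Λ`;
all four points are arbitrary vertices of `Λ` (coincidences allowed, the spin products being
`σ_{A}` for the symmetric differences `A = {x₁} ∆ {x₂} ∆ {x₃} ∆ {x₄}`). This "inequality
complementary to Lebowitz' inequality" is the input of the proof that `γ = 1` under the bubble
condition (Tasaki–Hara 2015, Thm. 10.13; Aizenman 1982, Prop. 7.1; Aizenman–Graham 1983;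
`Literature/Barriers/CriticalPhenomena/LaceExpansionIsingAboveFourBubbleBound.lean`).

## Part I. Random-current tools (sequel of `ModifiedSimonInequality`, `FieldCurrents`)

Currents `n : ℰ_Λ → ℕ` on the edges of `Λ`, sums in `ℝ≥0∞`. The random cluster `C_{n₁+n₂}(b)` of a
vertex is conditioned upon by summing over the value `S` of its complement
`𝒮_b(n₁+n₂) = Λ ∖ C_{n₁+n₂}(b)` (`FieldCurrents.clusterCompl`), so that no random ratio
`⟨σ_pσ_q⟩_{Λ ∖ C}` (Tasaki–Hara's notation) ever appears.

* `cpairSum G Λ β E₁ E₂ X Y F = ∑_{n₁ ⊆ E₁, ∂n₁ = X} ∑_{n₂ ⊆ E₂, ∂n₂ = Y} w(n₁) w(n₂) F(n₁ + n₂)`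
  (pairs of currents with prescribed supports and sources) and its bookkeeping;
* `cpairSum_switching` — the **switching lemma in two-sided form** (Tasaki–Hara 2015, Lemma A.10,
  eq. (A.90); Griffiths–Hurst–Sherman 1970; Aizenman 1982): for `E₂ ⊆ E₁`,
  `cpairSum E₁ E₂ X Y (F·𝟙[u ↔ v in E₂]) = cpairSum E₁ E₂ (X ∆ {u,v}) (Y ∆ {u,v}) (F·𝟙[u ↔ v in E₂])`
  (the nested case `E₂ = ℰ_S ⊊ E₁ = ℰ_Λ` is the "`in Ω`" version of (A.90));
* `cpairSum_clusterCompl_eq` — **conditioning on a cluster** (Tasaki–Hara 2015, Lemma A.19 and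
  its proof, (A.128)–(A.132); Duminil-Copin–Tassion 2016, proof of Lemma 2.6, Claims 1–2): on the
  event `𝒮_b(n₁+n₂) = S` the pair sum factorises into a pair sum of currents inside `S` (with any
  functional of the inner parts) and an outer factor `outerPairSum` (currents inside `Λ ∖ S`
  connecting all of `Λ ∖ S` to `b`, with any functional of the outer parts);
* `cconn_iff_not_cconn_of_csources_eq` — parity of four sources inside a cluster ("`x₄` is
  connected to exactly one of `x₁`, `x₂`", Tasaki–Hara 2015, proof of (A.136));
* `currentZ_mul_currentZ_le_add` — the **generalised modified Simon inequality** behind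
  (A.138)–(A.144) (ibid., with Lemma A.16): for `x₃ ∈ S ⊆ Λ` and any `x₁`,
  `Z_Λ({x₁}∆{x₃}) Z_S(∅) ≤ Z_S({x₁}∆{x₃}) Z_Λ(∅) + tanh β ∑_{u ∈ S} ∑_{v ∈ Λ∖S, v ∼ u} Z_Λ({v}∆{x₁}) Z_S({x₃}∆{u})`,
  i.e. `⟨σ₁σ₃⟩_Λ - ⟨σ₁σ₃⟩_S ≤ ∑_{u ∈ S, v ∉ S} ⟨σ₃σ_u⟩_S tanh(β J_{uv}) ⟨σ_vσ₁⟩_Λ` ((A.142) with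
  `A = Λ ∖ S ∌ x₃`); for `x₁ ∉ S` it is the tree's `currentZ_mul_currentZ_le`
  (Duminil-Copin–Tassion 2016, Lemma 2.7).

## Part II. The proof of the inequality (Tasaki–Hara 2015, App. A, §3.6, (A.133)–(A.151)), decomposed

All identities are between `ℝ≥0∞`-valued pair sums, multiplied through by powers of
`Z = Z_Λ(∅)`. With `A_{ij} = {xᵢ} ∆ {xⱼ}`, `A = A₁₂ ∆ A₃₄`:

1. `Z(A) Z(∅) = Z(A₁₂) Z(A₃₄) + ∑_{∂n₁ = A, ∂n₂ = ∅} w w 𝟙[x₃ ↮ x₄]` (switching; (A.135)), and the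
   last sum splits as `∑_{∂n₁ = A₁₃, ∂n₂ = A₂₄} w w 𝟙[x₃ ↮ x₄] + ∑_{∂n₁ = A₂₃, ∂n₂ = A₁₄} w w 𝟙[x₃ ↮ x₄]`
   (exactly one of `x₁, x₂` lies in the cluster of `x₄`; switching back; (A.136)); hence
   `Z² U₄ = -∑_{A₁₃, A₂₄} w w 𝟙[x₃ ↔ x₄] - ∑_{A₂₃, A₁₄} w w 𝟙[x₃ ↔ x₄]` ((A.134),
   `currentZ_ursell_identity`).
2. `∑_{∂n₁ = A_{uv} ∆ A₃₄, ∂n₂ = ∅} w w 𝟙[x₃ ↮ x₄] = R₃₄(u,v) + R₄₃(u,v)` with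
   `R₃₄(u,v) = ∑_{S ∌ x₃,u; ∋ x₄,v} Z_S({x₄}∆{v}) Z_S(∅) Ψ^{x₃}_S({x₃}∆{u}, ∅)` (`agR`; conditioning on
   the cluster of `x₃`, resp. `x₄`; this is (A.133) for `Z² ⟨σ_uσ_v ; σ₃σ₄⟩`,
   `currentZ_four_mul_currentZ_empty_eq_agR`).
3. `Z² ∑_{A₁₃, A₂₄} w w 𝟙[x₃ ↔ x₄] ≤ tanh β ∑_{u ∼ v} Z({v}∆{x₁}) Z({x₂}∆{v}) R₃₄(u,v) + Z Z(A₁₃) Z(A₄₃) Z(A₂₃)`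
   (`cpairSum_pair_pair_conn_le`): condition on the cluster of `x₄` ((A.145)); on
   `{𝒮_{x₄} = S ∋ x₃}` apply `currentZ_mul_currentZ_le_add` to `Z(A₁₃) Z_S(∅)` ((A.142));
   the terms with `x₃ ∉ S` resum by switching to `Z(A₁₃)Z(A₄₃)Z(A₂₃)` ((A.146)); in the others
   exchange the sums, undo the conditioning, condition on the cluster of `x₃` instead
   ((A.147)–(A.149)), switch inside `S'` ((A.150)) and bound
   `Z(∅) Z_{S'}({x₂}∆{v}) ≤ Z({x₂}∆{v}) Z_{S'}(∅)` (Griffiths II, volume monotonicity; (A.151)).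
4. Add the bound of 3 and its copy with `x₃ ↔ x₄` exchanged, insert 2 and 1, pass to real numbers
   and divide by `Z⁴` (`aizenmanGraham_inequality_isingCorr`).

Design: the coupling is the nearest-neighbour one of the tree (`J ≡ 1` on the edges of `G`), so
Tasaki–Hara's `tanh Ĵ_{u,v}` is `tanh β · 1_{u ∼ v}` and their `∑_{u,v}` becomes the sum over
ordered adjacent pairs of `Λ`. What is NOT here: the Aizenman inequality (A.124) (Thm. A.17), the
field versions (ABF, Thm. A.20), infinite-volume statements.

## References

* H. Tasaki, T. Hara, *相転移と臨界現象の数理* (Mathematical theory of phase transitions and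
  critical phenomena), Kyoritsu 2015: Appendix A, §3.2 (Lemma A.10, eq. (A.90)), §3.5
  (Lemma A.16), §3.6 (Theorem A.18 = eq. (A.125), Lemma A.19, proof (A.133)–(A.151)); Chapter 10,
  §3.3, eq. (10.65) [TasakiHara2015].
* M. Aizenman, R. Graham, Nucl. Phys. B 225 (1983) 261–288 [AizenmanGraham1983].
* M. Aizenman, Comm. Math. Phys. 86 (1982) 1–48, Lemma 3.2, Props. 5.1–5.3, Prop. 7.1
  [AizenmanCMP1982].
* H. Duminil-Copin, V. Tassion, Comm. Math. Phys. 343 (2016) 725, Lemmas 2.5–2.7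
  (arXiv:1502.03050 numbering) [DuminilCopinTassionCMP2016].
* H. Duminil-Copin, *Random currents expansion of the Ising model*, arXiv:1607.06933, §3,
  Lemma 3.1 [DuminilCopinECM2018].
-/

noncomputable section

open Finset MeasureTheory
open scoped symmDiff ENNReal

namespace Literature.Probability.LatticeModels

variable {V : Type*} [DecidableEq V]

/-! ## Part I. Random-current tools -/

section Tools

variable {G : SimpleGraph V} [G.LocallyFinite] {Λ : Finset V}

/-! ### Pair sums of currents with prescribed supports and sources -/

variable (G Λ) in
/-- The pair sum `∑_{n₁ ⊆ E₁, ∂n₁ = X} ∑_{n₂ ⊆ E₂, ∂n₂ = Y} w_β(n₁) w_β(n₂) F(n₁ + n₂)` over pairs of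
currents on the edges of `G` inside `Λ`, the first supported in `E₁`, the second in `E₂`
(Tasaki–Hara 2015, Lemma A.10: the double sums `∑_{m ∈ 𝒩_Λ, ∂m = A} ∑_{n ∈ 𝒩_Ω, ∂n = B} w(m)w(n)f(m+n)`;
Duminil-Copin–Tassion 2016, Lemma 2.5). [cite: TasakiHara2015, Appendix A, Lemma A.10, eq. (A.89)–(A.90)] -/
def cpairSum (β : ℝ) (E₁ E₂ : Finset (Sym2 V)) (X Y : Finset V)
    (F : (edgesIn G Λ → ℕ) → ℝ≥0∞) : ℝ≥0∞ :=
  ∑' p : (edgesIn G Λ → ℕ) × (edgesIn G Λ → ℕ),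
    ind (csources G Λ p.1 = X ∧ CSupp G Λ E₁ p.1) * ind (csources G Λ p.2 = Y ∧ CSupp G Λ E₂ p.2) *
      (cweight G Λ β p.1 * cweight G Λ β p.2 * F (p.1 + p.2))

/-- The pair sum with `F = 1` is the product `Z_{E₁}(X) Z_{E₂}(Y)` of the two generating sums. [folklore] -/
theorem cpairSum_one (β : ℝ) (E₁ E₂ : Finset (Sym2 V)) (X Y : Finset V) :
    cpairSum G Λ β E₁ E₂ X Y (fun _ => 1) = currentZ G Λ β E₁ X * currentZ G Λ β E₂ Y := by
  unfold cpairSum currentZ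
  rw [tsum_mul_tsum_eq_tsum_prod]
  exact tsum_congr fun p => by ring

/-- Monotonicity of the pair sum in `F` on currents with the prescribed sources and supports. [folklore] -/
theorem cpairSum_mono {β : ℝ} {E₁ E₂ : Finset (Sym2 V)} {X Y : Finset V}
    {F F' : (edgesIn G Λ → ℕ) → ℝ≥0∞}
    (h : ∀ n₁ n₂, csources G Λ n₁ = X → CSupp G Λ E₁ n₁ → csources G Λ n₂ = Y → CSupp G Λ E₂ n₂ →
      F (n₁ + n₂) ≤ F' (n₁ + n₂)) :
    cpairSum G Λ β E₁ E₂ X Y F ≤ cpairSum G Λ β E₁ E₂ X Y F' := by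
  unfold cpairSum
  refine ENNReal.tsum_le_tsum fun p => ?_
  by_cases h1 : csources G Λ p.1 = X ∧ CSupp G Λ E₁ p.1
  · by_cases h2 : csources G Λ p.2 = Y ∧ CSupp G Λ E₂ p.2
    · have := h p.1 p.2 h1.1 h1.2 h2.1 h2.2
      gcongr
    · rw [ind_of_false h2, mul_zero, zero_mul, zero_mul]
  · rw [ind_of_false h1, zero_mul, zero_mul, zero_mul]

/-- The pair sum only depends on `F` on currents with the prescribed sources and supports. [folklore] -/
theorem cpairSum_congr {β : ℝ} {E₁ E₂ : Finset (Sym2 V)} {X Y : Finset V}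
    {F F' : (edgesIn G Λ → ℕ) → ℝ≥0∞}
    (h : ∀ n₁ n₂, csources G Λ n₁ = X → CSupp G Λ E₁ n₁ → csources G Λ n₂ = Y → CSupp G Λ E₂ n₂ →
      F (n₁ + n₂) = F' (n₁ + n₂)) :
    cpairSum G Λ β E₁ E₂ X Y F = cpairSum G Λ β E₁ E₂ X Y F' :=
  le_antisymm (cpairSum_mono fun m₁ m₂ h1 h1' h2 h2' => (h m₁ m₂ h1 h1' h2 h2').le)
    (cpairSum_mono fun m₁ m₂ h1 h1' h2 h2' => (h m₁ m₂ h1 h1' h2 h2').ge)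

/-- Monotonicity of the pair sum in `F`, unconditional form. [folklore] -/
theorem cpairSum_mono' {β : ℝ} {E₁ E₂ : Finset (Sym2 V)} {X Y : Finset V}
    {F F' : (edgesIn G Λ → ℕ) → ℝ≥0∞} (h : ∀ m, F m ≤ F' m) :
    cpairSum G Λ β E₁ E₂ X Y F ≤ cpairSum G Λ β E₁ E₂ X Y F' :=
  cpairSum_mono fun _ _ _ _ _ _ => h _

/-- Additivity of the pair sum in `F`. [folklore] -/
theorem cpairSum_add (β : ℝ) (E₁ E₂ : Finset (Sym2 V)) (X Y : Finset V)
    (F F' : (edgesIn G Λ → ℕ) → ℝ≥0∞) :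
    cpairSum G Λ β E₁ E₂ X Y (fun m => F m + F' m) =
      cpairSum G Λ β E₁ E₂ X Y F + cpairSum G Λ β E₁ E₂ X Y F' := by
  unfold cpairSum
  rw [← ENNReal.tsum_add]
  exact tsum_congr fun p => by ring

/-- The pair sum commutes with finite sums in `F`. [folklore] -/
theorem cpairSum_finset_sum {ι : Type*} (β : ℝ) (E₁ E₂ : Finset (Sym2 V)) (X Y : Finset V)
    (s : Finset ι) (F : ι → (edgesIn G Λ → ℕ) → ℝ≥0∞) :
    cpairSum G Λ β E₁ E₂ X Y (fun m => ∑ i ∈ s, F i m) = ∑ i ∈ s, cpairSum G Λ β E₁ E₂ X Y (F i) := by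
  classical
  induction s using Finset.induction_on with
  | empty =>
    simp only [sum_empty]
    unfold cpairSum
    simp
  | insert i s hi ih =>
    simp only [sum_insert hi]
    rw [← ih, ← cpairSum_add]

/-- Constants come out of the pair sum. [folklore] -/
theorem cpairSum_mul_left (β : ℝ) (E₁ E₂ : Finset (Sym2 V)) (X Y : Finset V) (c : ℝ≥0∞)
    (F : (edgesIn G Λ → ℕ) → ℝ≥0∞) :
    cpairSum G Λ β E₁ E₂ X Y (fun m => c * F m) = c * cpairSum G Λ β E₁ E₂ X Y F := by
  unfold cpairSum
  rw [← ENNReal.tsum_mul_left]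
  exact tsum_congr fun p => by ring

/-- A pair sum against `F ≤ 1` is at most `Z_{E₁}(X) Z_{E₂}(Y)`. [folklore] -/
theorem cpairSum_le_currentZ_mul {β : ℝ} {E₁ E₂ : Finset (Sym2 V)} {X Y : Finset V}
    {F : (edgesIn G Λ → ℕ) → ℝ≥0∞} (h : ∀ m, F m ≤ 1) :
    cpairSum G Λ β E₁ E₂ X Y F ≤ currentZ G Λ β E₁ X * currentZ G Λ β E₂ Y := by
  rw [← cpairSum_one]
  exact cpairSum_mono' h

/-- Symmetry of the pair sum under the exchange of the two currents. [folklore] -/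
theorem cpairSum_comm (β : ℝ) (E₁ E₂ : Finset (Sym2 V)) (X Y : Finset V)
    (F : (edgesIn G Λ → ℕ) → ℝ≥0∞) :
    cpairSum G Λ β E₁ E₂ X Y F = cpairSum G Λ β E₂ E₁ Y X F := by
  unfold cpairSum
  rw [← (Equiv.prodComm (edgesIn G Λ → ℕ) (edgesIn G Λ → ℕ)).tsum_eq]
  refine tsum_congr fun p => ?_
  simp only [Equiv.prodComm_apply, Prod.fst_swap, Prod.snd_swap]
  rw [add_comm p.2 p.1]
  ring

/-- The pair sum over all currents of `Λ`: the support conditions are vacuous. [folklore] -/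
theorem cpairSum_edgesIn_eq (β : ℝ) (X Y : Finset V) (F : (edgesIn G Λ → ℕ) → ℝ≥0∞) :
    cpairSum G Λ β (edgesIn G Λ) (edgesIn G Λ) X Y F =
      ∑' p : (edgesIn G Λ → ℕ) × (edgesIn G Λ → ℕ),
        ind (csources G Λ p.1 = X) * ind (csources G Λ p.2 = Y) *
          (cweight G Λ β p.1 * cweight G Λ β p.2 * F (p.1 + p.2)) := by
  unfold cpairSum
  refine tsum_congr fun p => ?_
  rw [ind_congr (show (csources G Λ p.1 = X ∧ CSupp G Λ (edgesIn G Λ) p.1) ↔ csources G Λ p.1 = X from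
      ⟨fun h => h.1, fun h => ⟨h, csupp_edgesIn _⟩⟩),
    ind_congr (show (csources G Λ p.2 = Y ∧ CSupp G Λ (edgesIn G Λ) p.2) ↔ csources G Λ p.2 = Y from
      ⟨fun h => h.1, fun h => ⟨h, csupp_edgesIn _⟩⟩)]

/-! ### Resummation over the multigraph and the two-sided switching lemma -/

/-- Supports are monotone in the edge set. [folklore] -/
theorem CSupp.mono {E E' : Finset (Sym2 V)} (h : E ⊆ E') {n : edgesIn G Λ → ℕ} (hn : CSupp G Λ E n) :
    CSupp G Λ E' n := fun e he => h (hn e he)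

variable (G Λ) in
/-- **Resummation of a pair sum over the multigraph `m = n₁ + n₂`** (Tasaki–Hara 2015, proof of
Lemma A.10 via Lemma A.11; Duminil-Copin 2016, proof of Lemma 3.1): for `E₂ ⊆ E₁`,
`cpairSum E₁ E₂ X Y F = ∑_{m ⊆ E₁, ∂m = X ∆ Y} w(m) F(m) N_m(E₂, Y)` with the binomially weighted
count `N_m(E₂, Y)` of sub-currents of `m` inside `E₂` with sources `Y` (`switchCount`). [cite: TasakiHara2015, Appendix A, Lemma A.11 and proof of Lemma A.10] -/
theorem cpairSum_eq_tsum_switchCount {β : ℝ} (hβ : 0 ≤ β) {E₁ E₂ : Finset (Sym2 V)} (h21 : E₂ ⊆ E₁)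
    (X Y : Finset V) (F : (edgesIn G Λ → ℕ) → ℝ≥0∞) :
    cpairSum G Λ β E₁ E₂ X Y F =
      ∑' m : edgesIn G Λ → ℕ, cweight G Λ β m *
        (F m * ind (CSupp G Λ E₁ m) * (ind (csources G Λ m = X ∆ Y) * switchCount G Λ m E₂ Y)) := by
  set Φ : (edgesIn G Λ → ℕ) → (edgesIn G Λ → ℕ) → ℝ≥0∞ := fun m n =>
    F m * (ind (csources G Λ (m - n) = X ∧ CSupp G Λ E₁ (m - n)) *
      ind (csources G Λ n = Y ∧ CSupp G Λ E₂ n)) with hΦ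
  have hL : ∀ p : (edgesIn G Λ → ℕ) × (edgesIn G Λ → ℕ),
      ind (csources G Λ p.1 = X ∧ CSupp G Λ E₁ p.1) *
          ind (csources G Λ p.2 = Y ∧ CSupp G Λ E₂ p.2) *
            (cweight G Λ β p.1 * cweight G Λ β p.2 * F (p.1 + p.2)) =
        cweight G Λ β p.1 * cweight G Λ β p.2 * Φ (p.1 + p.2) p.2 := by
    intro p
    have hsub : p.1 + p.2 - p.2 = p.1 := by
      funext e; simp
    simp only [hΦ, hsub]
    ring
  unfold cpairSum
  simp_rw [hL]
  rw [tsum_pair_eq_tsum_cbinom G Λ hβ Φ]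
  refine tsum_congr fun m => ?_
  congr 1
  have hinner : ∀ n, cbinom G Λ m n * Φ m n =
      F m * ind (CSupp G Λ E₁ m) * (cbinom G Λ m n *
        ind (csources G Λ (m - n) = X ∧ (csources G Λ n = Y ∧ CSupp G Λ E₂ n))) := by
    intro n
    by_cases hC : cbinom G Λ m n = 0
    · rw [hC, zero_mul, zero_mul, mul_zero]
    · have hle : n ≤ m := fun e => le_of_cbinom_ne_zero hC e
      simp only [hΦ]
      have hind : ind (csources G Λ (m - n) = X ∧ CSupp G Λ E₁ (m - n)) *
          ind (csources G Λ n = Y ∧ CSupp G Λ E₂ n) =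
          ind (CSupp G Λ E₁ m) * ind (csources G Λ (m - n) = X ∧ (csources G Λ n = Y ∧ CSupp G Λ E₂ n)) := by
        rw [← ind_and, ← ind_and]
        refine ind_congr ⟨fun ⟨⟨h1, h2⟩, h3, h4⟩ => ⟨?_, h1, h3, h4⟩, fun ⟨h0, h1, h3, h4⟩ => ⟨⟨h1, ?_⟩, h3, h4⟩⟩
        · exact ((csupp_tsub_and_iff m n E₁).1 ⟨h2, h4.mono h21⟩).1
        · exact ((csupp_tsub_and_iff m n E₁).2 ⟨h0, h4.mono h21⟩).1
      rw [hind]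
      ring
  simp_rw [hinner]
  rw [ENNReal.tsum_mul_left, tsum_cbinom_ind_eq]

/-- `(X ∆ T) ∆ (Y ∆ T) = X ∆ Y`. [folklore] -/
theorem symmDiff_symmDiff_symmDiff_cancel (X Y T : Finset V) : (X ∆ T) ∆ (Y ∆ T) = X ∆ Y := by
  rw [symmDiff_symmDiff_symmDiff_comm, symmDiff_self, symmDiff_bot]

variable (G Λ) in
/-- **The switching lemma, two-sided form** (Tasaki–Hara 2015, Lemma A.10, eq. (A.90) — "source
switching", there with `n ∈ 𝒩_Ω` on the sub-volume and the connection `x ↔ y in Ω`;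
Griffiths–Hurst–Sherman 1970; Aizenman 1982, Lemma 3.2; Duminil-Copin–Tassion 2016, Lemma 2.5):
for `E₂ ⊆ E₁`, sources `X, Y`, vertices `u, v` and any `F ≥ 0`,
`∑_{n₁ ⊆ E₁, ∂n₁ = X} ∑_{n₂ ⊆ E₂, ∂n₂ = Y} w w F(n₁+n₂) 𝟙[u ↔ v in E₂]
   = ∑_{∂n₁ = X ∆ {u,v}} ∑_{∂n₂ = Y ∆ {u,v}} w w F(n₁+n₂) 𝟙[u ↔ v in E₂]`,
where `{u,v}` is the symmetric difference `{u} ∆ {v}` and the connection is through edges of `E₂`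
charged by `n₁ + n₂`. Proof: resum both sides over `m = n₁ + n₂`
(`cpairSum_eq_tsum_switchCount`) and use `N_m(E₂, Y) = N_m(E₂, Y ∆ {u,v})` when `u ↔ v`
(`switchCount_eq_of_cconn`). [cite: TasakiHara2015, Appendix A, Lemma A.10, eq. (A.90)] -/
theorem cpairSum_switching {β : ℝ} (hβ : 0 ≤ β) {E₁ E₂ : Finset (Sym2 V)} (h21 : E₂ ⊆ E₁)
    (X Y : Finset V) (u v : V) (F : (edgesIn G Λ → ℕ) → ℝ≥0∞) :
    cpairSum G Λ β E₁ E₂ X Y (fun m => F m * ind (CConn G Λ m E₂ u v)) =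
      cpairSum G Λ β E₁ E₂ (X ∆ ({u} ∆ {v})) (Y ∆ ({u} ∆ {v}))
        (fun m => F m * ind (CConn G Λ m E₂ u v)) := by
  rw [cpairSum_eq_tsum_switchCount G Λ hβ h21, cpairSum_eq_tsum_switchCount G Λ hβ h21]
  refine tsum_congr fun m => ?_
  rw [symmDiff_symmDiff_symmDiff_cancel]
  by_cases hc : CConn G Λ m E₂ u v
  · rw [← switchCount_eq_of_cconn m hc Y]
  · simp only [ind_of_false hc, mul_zero, zero_mul]

/-- A current with sources `{u} ∆ {v}` supported in `E₂` connects `u` to `v` through charged edges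
of `E₂` (handshake; the case `u = v` is the reflexivity of the connection). [folklore] -/
theorem cconn_of_csources_eq_of_csupp {n : edgesIn G Λ → ℕ} {E₂ : Finset (Sym2 V)} {u v : V}
    (hsrc : csources G Λ n = {u} ∆ {v}) (hs : CSupp G Λ E₂ n) : CConn G Λ n E₂ u v := by
  by_cases huv : u = v
  · subst huv; exact Relation.ReflTransGen.refl
  · exact (cconn_of_csources_eq huv hsrc).of_csupp hs

variable (G Λ) in
/-- Switching into a pair of sources: the connection indicator is automatic when the second current
has sources `{u} ∆ {v}` inside `E₂`, so
`∑_{∂n₁ = X} ∑_{∂n₂ = {u,v} ⊆ E₂} w w F 𝟙[u ↔ v in E₂] = ∑_{∂n₁ = X} ∑_{∂n₂ = {u,v}} w w F`. [folklore] -/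
theorem cpairSum_conn_eq_of_sources_right (β : ℝ) (E₁ E₂ : Finset (Sym2 V)) (X : Finset V) (u v : V)
    (F : (edgesIn G Λ → ℕ) → ℝ≥0∞) :
    cpairSum G Λ β E₁ E₂ X ({u} ∆ {v}) (fun m => F m * ind (CConn G Λ m E₂ u v)) =
      cpairSum G Λ β E₁ E₂ X ({u} ∆ {v}) F := by
  refine cpairSum_congr fun n₁ n₂ _ _ h2 h2' => ?_
  rw [ind_of_true ((cconn_of_csources_eq_of_csupp h2 h2').mono (m' := n₁ + n₂)
    fun e => Nat.le_add_left _ _), mul_one]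

variable (G Λ) in
/-- The same with the connected pair among the sources of the first current (connection through
the larger edge set `E₁`). [folklore] -/
theorem cpairSum_conn_eq_of_sources_left (β : ℝ) (E₁ E₂ : Finset (Sym2 V)) (Y : Finset V) (u v : V)
    (F : (edgesIn G Λ → ℕ) → ℝ≥0∞) :
    cpairSum G Λ β E₁ E₂ ({u} ∆ {v}) Y (fun m => F m * ind (CConn G Λ m E₁ u v)) =
      cpairSum G Λ β E₁ E₂ ({u} ∆ {v}) Y F := by
  refine cpairSum_congr fun n₁ n₂ h1 h1' _ _ => ?_
  rw [ind_of_true ((cconn_of_csources_eq_of_csupp h1 h1').mono (m' := n₁ + n₂)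
    fun e => Nat.le_add_right _ _), mul_one]

variable (G Λ) in
/-- **Switching a connected pair out of the second current** (Tasaki–Hara 2015, (A.90) read from
left to right; Duminil-Copin–Tassion 2016, Lemma 2.5): for `E₂ ⊆ E₁`,
`Z`-form `∑_{∂n₁ = X ⊆ E₁} ∑_{∂n₂ = {u,v} ⊆ E₂} w w F = ∑_{∂n₁ = X ∆ {u,v}} ∑_{∂n₂ = ∅} w w F 𝟙[u ↔ v in E₂]`. [cite: TasakiHara2015, Appendix A, Lemma A.10, eq. (A.90)] -/
theorem cpairSum_pair_eq_pairSum_empty_conn {β : ℝ} (hβ : 0 ≤ β) {E₁ E₂ : Finset (Sym2 V)} (h21 : E₂ ⊆ E₁)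
    (X : Finset V) (u v : V) (F : (edgesIn G Λ → ℕ) → ℝ≥0∞) :
    cpairSum G Λ β E₁ E₂ X ({u} ∆ {v}) F =
      cpairSum G Λ β E₁ E₂ (X ∆ ({u} ∆ {v})) ∅ (fun m => F m * ind (CConn G Λ m E₂ u v)) := by
  rw [← cpairSum_conn_eq_of_sources_right G Λ β E₁ E₂ X u v F, cpairSum_switching G Λ hβ h21,
    symmDiff_self]
  rfl

/-! ### Restriction of weights across a cut -/

/-- `w(n) = w(n^{E}) w(n^{E'})` for a current with no charge outside the disjoint union `E ⊔ E'`
(constant coupling). [cite: DuminilCopinTassionCMP2016, proof of Lemma 2.6, Claim 1 (arXiv:1502.03050 numbering)] -/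
theorem cweight_eq_mul_of_csupp_union (β : ℝ) {E E' : Finset (Sym2 V)} (hdisj : Disjoint E E')
    {n : edgesIn G Λ → ℕ} (hs : CSupp G Λ (E ∪ E') n) :
    cweight G Λ β n = cweight G Λ β (crestr G Λ E n) * cweight G Λ β (crestr G Λ E' n) :=
  gweight_eq_mul_of_csupp_union (fun _ => β) hdisj hs

/-! ### Conditioning on the cluster of a vertex: factorisation of pair sums on `{𝒮_b = S}` -/

variable (G Λ) in
/-- The **outer factor** of a pair sum conditioned on `𝒮_b(n₁+n₂) = S`: pairs of currents inside
`Λ ∖ S` with prescribed sources, weighted by a functional `H` of their sum and by the indicator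
that every vertex of `Λ ∖ S` is joined to `b` through charged edges inside `Λ ∖ S` (so that
`Λ ∖ S` is exactly the cluster of `b`) (Tasaki–Hara 2015, proof of Lemma A.19, the currents
`n''ᵢ ∈ 𝒩_{Λ∖A}`; Duminil-Copin–Tassion 2016, proof of Lemma 2.6, Claim 1). [cite: TasakiHara2015, Appendix A, proof of Lemma A.19, (A.129)–(A.131)] -/
def outerPairSum (β : ℝ) (S : Finset V) (b : V) (X₂ Y₂ : Finset V)
    (H : (edgesIn G Λ → ℕ) → ℝ≥0∞) : ℝ≥0∞ :=
  ∑' q : (edgesIn G Λ → ℕ) × (edgesIn G Λ → ℕ),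
    ind (CSupp G Λ (edgesIn G (Λ \ S)) q.1 ∧ CSupp G Λ (edgesIn G (Λ \ S)) q.2) *
      (ind (csources G Λ q.1 = X₂) * ind (csources G Λ q.2 = Y₂) *
        (cweight G Λ β q.1 * cweight G Λ β q.2 *
          (H (q.1 + q.2) * ind (∀ v ∈ Λ \ S, CConn G Λ (q.1 + q.2) (edgesIn G (Λ \ S)) b v))))

/-- Monotonicity of the outer factor in `H`. [folklore] -/
theorem outerPairSum_mono {β : ℝ} {S : Finset V} {b : V} {X₂ Y₂ : Finset V}
    {H H' : (edgesIn G Λ → ℕ) → ℝ≥0∞} (h : ∀ m, H m ≤ H' m) :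
    outerPairSum G Λ β S b X₂ Y₂ H ≤ outerPairSum G Λ β S b X₂ Y₂ H' := by
  unfold outerPairSum
  refine ENNReal.tsum_le_tsum fun q => ?_
  have := h (q.1 + q.2)
  gcongr

/-- Symmetry of the outer factor under the exchange of the two currents. [folklore] -/
theorem outerPairSum_comm (β : ℝ) (S : Finset V) (b : V) (X₂ Y₂ : Finset V)
    (H : (edgesIn G Λ → ℕ) → ℝ≥0∞) :
    outerPairSum G Λ β S b X₂ Y₂ H = outerPairSum G Λ β S b Y₂ X₂ H := by
  unfold outerPairSum
  rw [← (Equiv.prodComm (edgesIn G Λ → ℕ) (edgesIn G Λ → ℕ)).tsum_eq]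
  refine tsum_congr fun p => ?_
  simp only [Equiv.prodComm_apply, Prod.fst_swap, Prod.snd_swap]
  rw [add_comm p.2 p.1, ind_congr (and_comm)]
  ring

/-- The inner factor is a pair sum of currents inside `S`. [folklore] -/
theorem tsum_inner_eq_cpairSum (β : ℝ) (S : Finset V) (X₁ Y₁ : Finset V)
    (H : (edgesIn G Λ → ℕ) → ℝ≥0∞) :
    ∑' a : (edgesIn G Λ → ℕ) × (edgesIn G Λ → ℕ),
        ind (CSupp G Λ (edgesIn G S) a.1 ∧ CSupp G Λ (edgesIn G S) a.2) *
          (ind (csources G Λ a.1 = X₁) * ind (csources G Λ a.2 = Y₁) *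
            (cweight G Λ β a.1 * cweight G Λ β a.2 * H (a.1 + a.2))) =
      cpairSum G Λ β (edgesIn G S) (edgesIn G S) X₁ Y₁ H := by
  unfold cpairSum
  refine tsum_congr fun a => ?_
  rw [ind_and, ind_and, ind_and]
  ring

/-- **Factorisation of a pair sum on the event `𝒮_b(n₁+n₂) = S`** (Tasaki–Hara 2015, Lemma A.19
and its proof: "condition the sum on `C_{n₁+n₂}(s) = A` … `nᵢ = nᵢ' + nᵢ''`, `w(nᵢ) = w(nᵢ')w(nᵢ'')`,
… the sum over `nᵢ''` can be carried out"; Duminil-Copin–Tassion 2016, proof of Lemma 2.6,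
Claims 1–2). For `S ⊆ Λ`, `b ∈ Λ ∖ S`, sources `X, Y` and functionals `H₁` of the parts inside
`ℰ_S` and `H₂` of the parts inside `ℰ_{Λ∖S}`:
`∑_{∂n₁ = X, ∂n₂ = Y} w w 𝟙[𝒮_b = S] H₁ H₂ = (∑_{a₁,a₂ ⊆ ℰ_S, ∂a₁ = X ∩ S, ∂a₂ = Y ∩ S} w w H₁(a₁+a₂)) · Ψ^b_S(X ∖ S, Y ∖ S; H₂)`,
`Ψ^b_S` the outer factor `outerPairSum`. [cite: TasakiHara2015, Appendix A, Lemma A.19, eqs. (A.127)–(A.132)] -/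
theorem cpairSum_clusterCompl_eq (β : ℝ) {S : Finset V} (hS : S ⊆ Λ) {b : V} (hb : b ∈ Λ \ S)
    (X Y : Finset V) (H₁ H₂ : (edgesIn G Λ → ℕ) → ℝ≥0∞) :
    cpairSum G Λ β (edgesIn G Λ) (edgesIn G Λ) X Y
        (fun m => ind (clusterCompl G Λ m b = S) *
          (H₁ (crestr G Λ (edgesIn G S) m) * H₂ (crestr G Λ (edgesIn G (Λ \ S)) m))) =
      cpairSum G Λ β (edgesIn G S) (edgesIn G S) (X.filter (· ∈ S)) (Y.filter (· ∈ S)) H₁ *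
        outerPairSum G Λ β S b (X.filter (· ∉ S)) (Y.filter (· ∉ S)) H₂ := by
  set E₁ := edgesIn G S with hE₁
  set E₂ := edgesIn G (Λ \ S) with hE₂
  have hdisj : Disjoint E₁ E₂ := disjoint_edgesIn_sdiff S
  -- pointwise rewriting of the summand
  set G₁ : (edgesIn G Λ → ℕ) → (edgesIn G Λ → ℕ) → ℝ≥0∞ := fun a₁ a₂ =>
    ind (csources G Λ a₁ = X.filter (· ∈ S)) * ind (csources G Λ a₂ = Y.filter (· ∈ S)) *
      (cweight G Λ β a₁ * cweight G Λ β a₂ * H₁ (a₁ + a₂)) with hG₁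
  set G₂ : (edgesIn G Λ → ℕ) → (edgesIn G Λ → ℕ) → ℝ≥0∞ := fun b₁ b₂ =>
    ind (csources G Λ b₁ = X.filter (· ∉ S)) * ind (csources G Λ b₂ = Y.filter (· ∉ S)) *
      (cweight G Λ β b₁ * cweight G Λ β b₂ *
        (H₂ (b₁ + b₂) * ind (∀ v ∈ Λ \ S, CConn G Λ (b₁ + b₂) E₂ b v))) with hG₂
  have hpt : ∀ p : (edgesIn G Λ → ℕ) × (edgesIn G Λ → ℕ),
      ind (csources G Λ p.1 = X) * ind (csources G Λ p.2 = Y) *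
          (cweight G Λ β p.1 * cweight G Λ β p.2 *
            (ind (clusterCompl G Λ (p.1 + p.2) b = S) *
              (H₁ (crestr G Λ E₁ (p.1 + p.2)) * H₂ (crestr G Λ E₂ (p.1 + p.2))))) =
        ind (CSupp G Λ (E₁ ∪ E₂) p.1) * ind (CSupp G Λ (E₁ ∪ E₂) p.2) *
          (G₁ (crestr G Λ E₁ p.1) (crestr G Λ E₁ p.2) * G₂ (crestr G Λ E₂ p.1) (crestr G Λ E₂ p.2)) := by
    intro p
    by_cases hcut : CSupp G Λ (E₁ ∪ E₂) p.1 ∧ CSupp G Λ (E₁ ∪ E₂) p.2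
    · obtain ⟨hc1, hc2⟩ := hcut
      have hc12 : CSupp G Λ (E₁ ∪ E₂) (p.1 + p.2) := (csupp_add_iff p.1 p.2).2 ⟨hc1, hc2⟩
      rw [ind_of_true hc1, ind_of_true hc2, one_mul, one_mul]
      -- sources
      have hsrc : ∀ (n : edgesIn G Λ → ℕ) (Z : Finset V), CSupp G Λ (E₁ ∪ E₂) n →
          (ind (csources G Λ n = Z) =
            ind (csources G Λ (crestr G Λ E₁ n) = Z.filter (· ∈ S)) *
              ind (csources G Λ (crestr G Λ E₂ n) = Z.filter (· ∉ S))) := by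
        intro n Z hn
        rw [← ind_and]
        refine ind_congr ?_
        rw [csources_crestr_inner hn, csources_crestr_outer hn]
        constructor
        · intro h
          rw [h]
          exact ⟨rfl, rfl⟩
        · rintro ⟨h1, h2⟩
          rw [← filter_union_filter_not_eq (· ∈ S) (csources G Λ n),
            ← filter_union_filter_not_eq (· ∈ S) Z, h1, h2]
      -- weights
      have hw1 := cweight_eq_mul_of_csupp_union β hdisj hc1
      have hw2 := cweight_eq_mul_of_csupp_union β hdisj hc2
      -- the event
      have hev : ind (clusterCompl G Λ (p.1 + p.2) b = S) =
          ind (∀ v ∈ Λ \ S, CConn G Λ (crestr G Λ E₂ p.1 + crestr G Λ E₂ p.2) E₂ b v) := by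
        refine ind_congr ?_
        rw [clusterCompl_eq_iff hS hb, ← crestr_add]
        simp only [hE₂, cconn_crestr_iff]
        exact ⟨fun h => h.2, fun h => ⟨hc12, h⟩⟩
      rw [hsrc p.1 X hc1, hsrc p.2 Y hc2, hw1, hw2, hev, crestr_add, crestr_add]
      simp only [hG₁, hG₂]
      ring
    · -- the event forces the cut condition
      have hzero : ind (clusterCompl G Λ (p.1 + p.2) b = S) = 0 ∨
          (CSupp G Λ (E₁ ∪ E₂) p.1 ∧ CSupp G Λ (E₁ ∪ E₂) p.2) := by
        by_cases hS' : clusterCompl G Λ (p.1 + p.2) b = S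
        · exact Or.inr ((csupp_add_iff p.1 p.2).1 (csupp_cut_of_clusterCompl_eq hS'))
        · exact Or.inl (ind_of_false hS')
      rcases hzero with h0 | h
      · rw [h0, zero_mul, mul_zero, mul_zero]
        rcases not_and_or.1 hcut with h1 | h2
        · rw [ind_of_false h1, zero_mul, zero_mul]
        · rw [ind_of_false h2, mul_zero, zero_mul]
      · exact absurd h hcut
  rw [cpairSum_edgesIn_eq]
  simp_rw [hpt]
  rw [tsum_pair_eq_mul_of_csupp_union G Λ hdisj G₁ G₂, tsum_inner_eq_cpairSum]
  rfl

/-- `∑_{S ⊆ Λ} 𝟙[𝒮_b(m) = S] f(S) = f(𝒮_b(m))`: decomposition of a pair sum according to the value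
of the cluster complement of `b` (Tasaki–Hara 2015, proof of Lemma A.19, (A.128)). [cite: TasakiHara2015, Appendix A, proof of Lemma A.19, eq. (A.128)] -/
theorem cpairSum_eq_sum_powerset_clusterCompl (β : ℝ) (X Y : Finset V) (b : V)
    (F : Finset V → (edgesIn G Λ → ℕ) → ℝ≥0∞) :
    cpairSum G Λ β (edgesIn G Λ) (edgesIn G Λ) X Y (fun m => F (clusterCompl G Λ m b) m) =
      ∑ S ∈ Λ.powerset, cpairSum G Λ β (edgesIn G Λ) (edgesIn G Λ) X Y
        (fun m => ind (clusterCompl G Λ m b = S) * F S m) := by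
  rw [← cpairSum_finset_sum]
  refine cpairSum_congr fun n₁ n₂ _ _ _ _ => ?_
  rw [sum_eq_single (clusterCompl G Λ (n₁ + n₂) b), ind_of_true rfl, one_mul]
  · intro S _ hS
    rw [ind_of_false fun h => hS h.symm, zero_mul]
  · intro h
    exact absurd (mem_powerset.2 (clusterCompl_subset (n₁ + n₂) b)) h

/-! ### Parity of four sources inside a cluster: "`x₄` is connected to exactly one of `x₁, x₂`" -/

/-- Filtering commutes with the symmetric difference. [folklore] -/
theorem filter_symmDiff_eq (A B : Finset V) (p : V → Prop) [DecidablePred p] :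
    (A ∆ B).filter p = (A.filter p) ∆ (B.filter p) := by
  ext x
  simp only [mem_filter, mem_symmDiff]
  tauto

/-- Parity of a filtered symmetric difference. [folklore] -/
theorem even_card_filter_symmDiff_iff (A B : Finset V) (p : V → Prop) [DecidablePred p] :
    Even #((A ∆ B).filter p) ↔ (Even #(A.filter p) ↔ Even #(B.filter p)) := by
  rw [filter_symmDiff_eq, even_card_symmDiff_iff]

omit [DecidableEq V] in
/-- Parity of a filtered singleton: even iff the predicate fails. [folklore] -/
theorem even_card_filter_singleton_iff (a : V) (p : V → Prop) [DecidablePred p] :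
    Even #(({a} : Finset V).filter p) ↔ ¬p a := by
  rw [filter_singleton]
  by_cases h : p a
  · rw [if_pos h, card_singleton]; simp [h]
  · rw [if_neg h, card_empty]; simp [h]

/-- **Exactly one of two sources lies in the cluster of a fourth** (Tasaki–Hara 2015, proof of
(A.136): "`x₄` is not connected to `x₃`, but since `∂n₁ = {x₁,x₂,x₃,x₄}` it is connected to
exactly one of `x₁`, `x₂`"; the handshake lemma on the cluster of `x₄`,
`even_card_csources_filter_cconn`, written with symmetric differences so that coincident points
are allowed): if `n ≤ m`, `∂n = ({a} ∆ {b}) ∆ ({c} ∆ {e})` and `e ↮ c` in `m`, then `e ↔ a` in `m`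
iff `e ↮ b` in `m`. [cite: TasakiHara2015, Appendix A, proof of Theorem A.18, eqs. (A.135)–(A.136)] -/
theorem cconn_iff_not_cconn_of_csources_eq {n m : edgesIn G Λ → ℕ} (hle : n ≤ m) {a b c e : V}
    (hsrc : csources G Λ n = ({a} ∆ {b}) ∆ ({c} ∆ {e}))
    (hce : ¬CConn G Λ m (edgesIn G Λ) e c) :
    CConn G Λ m (edgesIn G Λ) e a ↔ ¬CConn G Λ m (edgesIn G Λ) e b := by
  classical
  have hpar := even_card_csources_filter_cconn hle e
  rw [hsrc, even_card_filter_symmDiff_iff, even_card_filter_symmDiff_iff,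
    even_card_filter_symmDiff_iff, even_card_filter_singleton_iff, even_card_filter_singleton_iff,
    even_card_filter_singleton_iff, even_card_filter_singleton_iff] at hpar
  have hee : CConn G Λ m (edgesIn G Λ) e e := Relation.ReflTransGen.refl
  tauto

/-! ### Connections from inside `S` when no charged edge crosses the cut -/

/-- Connection through charged edges of any `E'` is connection through charged edges of `ℰ_Λ`. [folklore] -/
theorem CConn.to_edgesIn {m : edgesIn G Λ → ℕ} {E' : Finset (Sym2 V)} {u v : V}
    (h : CConn G Λ m E' u v) : CConn G Λ m (edgesIn G Λ) u v := by
  induction h with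
  | refl => exact Relation.ReflTransGen.refl
  | tail _ hbc ih =>
    obtain ⟨e, -, hpos, hes⟩ := hbc
    exact ih.tail ⟨e, e.2, hpos, hes⟩

/-- With no charged edge across the cut `(S, Λ ∖ S)` and `b ∈ S`, connections from `b` through
charged edges of `ℰ_Λ` are connections through charged edges inside `S` (companion of
`cconn_iff_cconn_outer`). [folklore] -/
theorem cconn_iff_cconn_inner {m : edgesIn G Λ → ℕ} {b : V} {S : Finset V}
    (hs : CSupp G Λ (edgesIn G S ∪ edgesIn G (Λ \ S)) m) (hb : b ∈ S) (v : V) :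
    CConn G Λ m (edgesIn G Λ) b v ↔ CConn G Λ m (edgesIn G S) b v := by
  refine ⟨fun h => ?_, fun h => h.to_edgesIn⟩
  suffices H : ∀ w, CConn G Λ m (edgesIn G Λ) b w →
      w ∈ S ∧ CConn G Λ m (edgesIn G S) b w from (H v h).2
  intro w hw
  induction hw with
  | refl => exact ⟨hb, Relation.ReflTransGen.refl⟩
  | @tail c c' _ hcc' ih =>
    obtain ⟨hc, hconn⟩ := ih
    obtain ⟨e, -, hpos, hes⟩ := hcc'
    have he' : (e : Sym2 V) ∈ edgesIn G S := by
      rcases mem_union.1 (hs e hpos.ne') with h1 | h2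
      · exact h1
      · exact absurd (mem_sdiff.1 ((mem_edgesIn_iff.1 h2).2 c (hes ▸ Sym2.mem_mk_left c c'))).2
          (not_not.2 hc)
    exact ⟨(mem_edgesIn_iff.1 he').2 c' (hes ▸ Sym2.mem_mk_right c c'),
      hconn.tail ⟨e, he', hpos, hes⟩⟩

/-! ### The generalised modified Simon inequality (Tasaki–Hara 2015, (A.138)–(A.144)) -/

/-- `𝟙[P] + 𝟙[¬P] = 1`. [folklore] -/
theorem ind_add_ind_not (P : Prop) : ind P + ind (¬P) = 1 := by
  by_cases h : P
  · rw [ind_of_true h, ind_of_false (not_not.2 h), add_zero]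
  · rw [ind_of_false h, ind_of_true h, zero_add]

/-- **Exit edge when the connection is not realised inside `S`.** If `a ∈ S` is connected to `z`
through charged edges of `ℰ_Λ` but not through charged edges inside `S`, the connection leaves
`S` through a charged edge `{x, y}`, `x ∈ S`, `y ∈ Λ ∖ S`, after connecting `a` to `x` inside `S`
(Tasaki–Hara 2015, proof of (A.142): "such a path must pass through `A`; let `{u,v}` be the bond
where it last leaves `A`"). [cite: TasakiHara2015, Appendix A, proof of eq. (A.142)–(A.143)] -/
theorem exists_exit_edge_of_not_cconn {n : edgesIn G Λ → ℕ} {S : Finset V} {a z : V}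
    (h : CConn G Λ n (edgesIn G Λ) a z) (ha : a ∈ S) (hz : ¬CConn G Λ n (edgesIn G S) a z) :
    ∃ x ∈ S, ∃ y ∈ Λ \ S, G.Adj x y ∧
      (∃ e : edgesIn G Λ, (e : Sym2 V) = s(x, y) ∧ 0 < n e) ∧ CConn G Λ n (edgesIn G S) a x := by
  suffices H : ∀ v, CConn G Λ n (edgesIn G Λ) a v →
      (v ∈ S ∧ CConn G Λ n (edgesIn G S) a v) ∨
      ∃ x ∈ S, ∃ y ∈ Λ \ S, G.Adj x y ∧
        (∃ e : edgesIn G Λ, (e : Sym2 V) = s(x, y) ∧ 0 < n e) ∧ CConn G Λ n (edgesIn G S) a x by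
    rcases H z h with ⟨-, hzS⟩ | hex
    · exact absurd hzS hz
    · exact hex
  intro v hv
  induction hv with
  | refl => exact Or.inl ⟨ha, Relation.ReflTransGen.refl⟩
  | @tail b c _ hbc ih =>
    rcases ih with ⟨hbS, hab⟩ | hex
    · obtain ⟨e, _, hpos, hes⟩ := hbc
      have hadj : G.Adj b c := by
        have := (mem_edgesIn_iff.1 e.2).1
        rw [hes] at this
        exact (SimpleGraph.mem_edgeSet G).1 this
      have hcΛ : c ∈ Λ := (mem_edgesIn_iff.1 e.2).2 c (hes ▸ Sym2.mem_mk_right b c)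
      by_cases hcS : c ∈ S
      · left
        refine ⟨hcS, hab.tail ⟨e, ?_, hpos, hes⟩⟩
        rw [mem_edgesIn_iff, hes]
        refine ⟨(SimpleGraph.mem_edgeSet G).2 hadj, fun w hw => ?_⟩
        rcases Sym2.mem_iff.1 hw with rfl | rfl
        · exact hbS
        · exact hcS
      · right
        exact ⟨b, hbS, c, mem_sdiff.2 ⟨hcΛ, hcS⟩, hadj, ⟨e, hes, hpos⟩, hab⟩
    · exact Or.inr hex

variable (G Λ) in
/-- A pair sum whose functional only sees the first current factorises:
`∑_{∂n₁ = X, ∂n₂ = Y} w w f(n₁) = (∑_{∂n₁ = X} w(n₁) f(n₁)) · Z_{E₂}(Y)`. [folklore] -/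
theorem cpairSum_eq_tsum_mul_currentZ (β : ℝ) (E₁ E₂ : Finset (Sym2 V)) (X Y : Finset V)
    (F : (edgesIn G Λ → ℕ) → ℝ≥0∞) (f : (edgesIn G Λ → ℕ) → ℝ≥0∞)
    (h : ∀ n₁ n₂, csources G Λ n₁ = X → CSupp G Λ E₁ n₁ → csources G Λ n₂ = Y → CSupp G Λ E₂ n₂ →
      F (n₁ + n₂) = f n₁) :
    cpairSum G Λ β E₁ E₂ X Y F =
      (∑' n, ind (csources G Λ n = X ∧ CSupp G Λ E₁ n) * cweight G Λ β n * f n) * currentZ G Λ β E₂ Y := by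
  unfold cpairSum currentZ
  rw [tsum_mul_tsum_eq_tsum_prod]
  refine tsum_congr fun p => ?_
  by_cases h1 : csources G Λ p.1 = X ∧ CSupp G Λ E₁ p.1
  · by_cases h2 : csources G Λ p.2 = Y ∧ CSupp G Λ E₂ p.2
    · rw [h p.1 p.2 h1.1 h1.2 h2.1 h2.2]
      ring
    · rw [ind_of_false h2]
      ring
  · rw [ind_of_false h1]
    ring

/-- `({x₁} ∆ {x₃}) ∆ ({x₃} ∆ {u}) = {x₁} ∆ {u}`. [folklore] -/
theorem symmDiff_pair_symmDiff_pair (x₁ x₃ u : V) :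
    (({x₁} ∆ {x₃}) ∆ ({x₃} ∆ {u}) : Finset V) = {x₁} ∆ {u} := by
  rw [symmDiff_assoc, ← symmDiff_assoc ({x₃} : Finset V), symmDiff_self, bot_symmDiff]

variable (G Λ) [DecidableRel G.Adj] in
/-- **The generalised modified Simon inequality, current form** (Tasaki–Hara 2015, (A.138) and
(A.142)–(A.144) with Lemma A.16, for `A = Λ ∖ S`; Duminil-Copin–Tassion 2016, Lemma 2.7 when
`x₁ ∉ S`): for `β ≥ 0`, `S ⊆ Λ`, `x₃ ∈ S` and any `x₁`,
`Z_Λ({x₁}∆{x₃}) Z_S(∅) ≤ Z_S({x₁}∆{x₃}) Z_Λ(∅) + tanh β ∑_{u ∈ S} ∑_{v ∈ Λ∖S, v ∼ u} Z_Λ({v}∆{x₁}) Z_S({x₃}∆{u})`.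
Proof: `Z_S({x₁}∆{x₃}) Z_Λ(∅) = ∑_{∂m = {x₁}∆{x₃}, ∂n = ∅ (n ⊆ ℰ_S)} w w 𝟙[x₁ ↔ x₃ in ℰ_S]`
(switching the sources into the current on `Λ`); on the complementary event the connection from
`x₃` to `x₁` forced by the sources of `m` leaves `S` through a charged edge `{u,v}` after joining
`x₃` to `u` inside `S`; switching `{x₃, u}` into `n` and removing the parity constraint on the exit
edge costs `tanh β` (`tsum_exit_edge_le`). [cite: TasakiHara2015, Appendix A, eqs. (A.138), (A.142)–(A.144) and Lemma A.16] -/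
theorem currentZ_mul_currentZ_le_add {β : ℝ} (hβ : 0 ≤ β) {S : Finset V} (hS : S ⊆ Λ) {x₁ x₃ : V}
    (hx₃ : x₃ ∈ S) :
    currentZ G Λ β (edgesIn G Λ) ({x₁} ∆ {x₃}) * currentZ G Λ β (edgesIn G S) ∅ ≤
      currentZ G Λ β (edgesIn G S) ({x₁} ∆ {x₃}) * currentZ G Λ β (edgesIn G Λ) ∅ +
        ∑ u ∈ S, ∑ v ∈ (Λ \ S).filter (G.Adj u),
          ENNReal.ofReal (Real.tanh β) * currentZ G Λ β (edgesIn G Λ) ({v} ∆ {x₁}) *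
            currentZ G Λ β (edgesIn G S) ({x₃} ∆ {u}) := by
  have hES : edgesIn G S ⊆ edgesIn G Λ := edgesIn_mono G hS
  set X : Finset V := {x₁} ∆ {x₃} with hX
  set P : (edgesIn G Λ → ℕ) → Prop := fun m => CConn G Λ m (edgesIn G S) x₁ x₃ with hP
  -- the two products as pair sums
  have hL : currentZ G Λ β (edgesIn G Λ) X * currentZ G Λ β (edgesIn G S) ∅ =
      cpairSum G Λ β (edgesIn G Λ) (edgesIn G S) X ∅ (fun m => ind (P m)) +
        cpairSum G Λ β (edgesIn G Λ) (edgesIn G S) X ∅ (fun m => ind (¬P m)) := by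
    rw [← cpairSum_one, ← cpairSum_add]
    exact cpairSum_congr fun n₁ n₂ _ _ _ _ => (ind_add_ind_not _).symm
  have hR : currentZ G Λ β (edgesIn G S) X * currentZ G Λ β (edgesIn G Λ) ∅ =
      cpairSum G Λ β (edgesIn G Λ) (edgesIn G S) X ∅ (fun m => ind (P m)) := by
    rw [mul_comm, ← cpairSum_one, cpairSum_pair_eq_pairSum_empty_conn G Λ hβ hES ∅ x₁ x₃,
      ← Finset.bot_eq_empty, bot_symmDiff]
    exact cpairSum_congr fun n₁ n₂ _ _ _ _ => by rw [one_mul]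
  rw [hL, hR]
  refine add_le_add le_rfl ?_
  -- the complementary event: first exit
  set Ψ : V → V → (edgesIn G Λ → ℕ) → ℝ≥0∞ := fun u v m =>
    ind (∃ e : edgesIn G Λ, (e : Sym2 V) = s(u, v) ∧ 0 < m e) * ind (CConn G Λ m (edgesIn G S) x₃ u)
    with hΨ
  have step1 : cpairSum G Λ β (edgesIn G Λ) (edgesIn G S) X ∅ (fun m => ind (¬P m)) ≤
      ∑ u ∈ S, ∑ v ∈ (Λ \ S).filter (G.Adj u),
        cpairSum G Λ β (edgesIn G Λ) (edgesIn G S) X ∅ (Ψ u v) := by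
    rw [← sum_congr rfl fun u _ => (cpairSum_finset_sum β (edgesIn G Λ) (edgesIn G S) X ∅ _ (Ψ u)),
      ← cpairSum_finset_sum]
    refine cpairSum_mono fun n₁ n₂ h1 _ h2 h2' => ?_
    by_cases hc : P (n₁ + n₂)
    · rw [ind_of_false (not_not.2 hc)]; exact zero_le
    · rw [ind_of_true hc]
      have h13 : x₁ ≠ x₃ := by
        rintro rfl; exact hc Relation.ReflTransGen.refl
      have hconn : CConn G Λ (n₁ + n₂) (edgesIn G Λ) x₃ x₁ :=
        ((cconn_of_csources_eq h13 h1).mono fun e => Nat.le_add_right _ _).symm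
      have hnot : ¬CConn G Λ (n₁ + n₂) (edgesIn G S) x₃ x₁ := fun h => hc h.symm
      obtain ⟨u, hu, v, hv, hadj, hex, hxu⟩ := exists_exit_edge_of_not_cconn hconn hx₃ hnot
      have hv' : v ∈ (Λ \ S).filter (G.Adj u) := mem_filter.2 ⟨hv, hadj⟩
      have hΨ1 : Ψ u v (n₁ + n₂) = 1 := by
        simp only [hΨ]
        rw [ind_of_true hex, ind_of_true hxu, mul_one]
      calc (1 : ℝ≥0∞) = Ψ u v (n₁ + n₂) := hΨ1.symm
        _ ≤ ∑ v ∈ (Λ \ S).filter (G.Adj u), Ψ u v (n₁ + n₂) :=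
            single_le_sum (f := fun v => Ψ u v (n₁ + n₂)) (fun _ _ => zero_le) hv'
        _ ≤ ∑ u ∈ S, ∑ v ∈ (Λ \ S).filter (G.Adj u), Ψ u v (n₁ + n₂) :=
            single_le_sum (f := fun u => ∑ v ∈ (Λ \ S).filter (G.Adj u), Ψ u v (n₁ + n₂))
              (fun _ _ => zero_le) hu
  refine step1.trans (sum_le_sum fun u hu => sum_le_sum fun v hv => ?_)
  -- Step 2: the pair `(u, v)`: switch `{x₃, u}` into the current on `S`
  obtain ⟨hv, hadj⟩ := mem_filter.1 hv
  obtain ⟨hvΛ, hvS⟩ := mem_sdiff.1 hv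
  have huΛ : u ∈ Λ := hS hu
  have he₀mem : s(u, v) ∈ edgesIn G Λ := by
    rw [mem_edgesIn_iff]
    refine ⟨(SimpleGraph.mem_edgeSet G).2 hadj, fun w hw => ?_⟩
    rcases Sym2.mem_iff.1 hw with rfl | rfl
    · exact huΛ
    · exact hvΛ
  set e₀ : edgesIn G Λ := ⟨s(u, v), he₀mem⟩ with he₀
  have hnotS : (e₀ : Sym2 V) ∉ edgesIn G S := fun h =>
    hvS ((mem_edgesIn_iff.1 h).2 v (Sym2.mem_mk_right u v))
  set Fuv : (edgesIn G Λ → ℕ) → ℝ≥0∞ := fun m => ind (∃ e : edgesIn G Λ, (e : Sym2 V) = s(u, v) ∧ 0 < m e)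
    with hFuv
  have hsw : cpairSum G Λ β (edgesIn G Λ) (edgesIn G S) X ∅ (Ψ u v) =
      cpairSum G Λ β (edgesIn G Λ) (edgesIn G S) ({x₁} ∆ {u}) ({x₃} ∆ {u})
        (fun m => Fuv m * ind (CConn G Λ m (edgesIn G S) x₃ u)) := by
    simp only [hΨ]
    rw [cpairSum_switching G Λ hβ hES X ∅ x₃ u Fuv, hX, symmDiff_pair_symmDiff_pair,
      ← Finset.bot_eq_empty, bot_symmDiff]
  rw [hsw, cpairSum_conn_eq_of_sources_right]
  -- Step 3: the exit-edge constraint only sees the current on `Λ`; factorise and apply `tanh`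
  rw [cpairSum_eq_tsum_mul_currentZ G Λ β (edgesIn G Λ) (edgesIn G S) ({x₁} ∆ {u}) ({x₃} ∆ {u}) Fuv
    (fun n => ind (0 < n e₀)) ?_]
  · have hsum : ∑' n, ind (csources G Λ n = {x₁} ∆ {u} ∧ CSupp G Λ (edgesIn G Λ) n) * cweight G Λ β n *
        ind (0 < n e₀) = ∑' n, ind (csources G Λ n = {u} ∆ {x₁} ∧ 0 < n e₀) * cweight G Λ β n := by
      refine tsum_congr fun n => ?_
      rw [mul_assoc, mul_comm (cweight G Λ β n), ← mul_assoc, ← ind_and]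
      congr 1
      refine ind_congr ⟨fun h => ⟨?_, h.2⟩, fun h => ⟨⟨?_, csupp_edgesIn n⟩, h.2⟩⟩
      · rw [h.1.1, symmDiff_comm]
      · rw [h.1, symmDiff_comm]
    rw [hsum]
    have hZ : currentZ G Λ β (edgesIn G Λ) ({v} ∆ {x₁}) = ∑' n, ind (csources G Λ n = {v} ∆ {x₁}) * cweight G Λ β n :=
      tsum_congr fun n => by rw [ind_congr ⟨fun h => h.1, fun h => ⟨h, csupp_edgesIn n⟩⟩]
    rw [hZ]
    exact mul_le_mul_left (tsum_exit_edge_le hβ x₁ e₀ rfl) _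
  · intro n₁ n₂ _ _ _ h2'
    simp only [hFuv]
    refine ind_congr ⟨fun ⟨e, hes, hpos⟩ => ?_, fun hpos => ⟨e₀, rfl, ?_⟩⟩
    · have hee : e = e₀ := Subtype.ext (by rw [hes])
      rw [hee] at hpos
      have h20 : n₂ e₀ = 0 := by
        by_contra hne
        exact hnotS (h2' e₀ hne)
      simpa [h20] using hpos
    · simp only [Pi.add_apply]
      omega

end Tools


/-! ## Part II. The Aizenman–Graham inequality -/

section AG

variable {G : SimpleGraph V} [G.LocallyFinite] {Λ : Finset V}

/-! ### Sources of currents inside a sub-volume; vanishing and finiteness of generating sums -/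

/-- The sources of a current supported on the edges inside `T` lie in `T`. [folklore] -/
theorem csources_subset_of_csupp {T : Finset V} {n : edgesIn G Λ → ℕ} (hs : CSupp G Λ (edgesIn G T) n) :
    csources G Λ n ⊆ T := by
  intro v hv
  have hodd : Odd (cdeg G Λ n v) := (mem_filter.1 hv).2
  have hne : cdeg G Λ n v ≠ 0 := fun h => by rw [h] at hodd; exact (Nat.not_odd_zero hodd).elim
  obtain ⟨e, -, he⟩ := Finset.exists_ne_zero_of_sum_ne_zero hne
  have hve : v ∈ (e : Sym2 V) := by
    by_contra h
    exact he (if_neg h)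
  have hn : n e ≠ 0 := fun h => he (by simp [h])
  exact (mem_edgesIn_iff.1 (hs e hn)).2 v hve

/-- `Z_{ℰ_T}(A) = 0` unless `A ⊆ T`. [folklore] -/
theorem currentZ_eq_zero_of_not_subset (β : ℝ) {T A : Finset V} (h : ¬A ⊆ T) :
    currentZ G Λ β (edgesIn G T) A = 0 := by
  unfold currentZ
  refine ENNReal.tsum_eq_zero.2 fun n => ?_
  rw [ind_of_false, zero_mul]
  rintro ⟨hsrc, hs⟩
  exact h (hsrc ▸ csources_subset_of_csupp hs)

/-- A pair sum of currents inside `T` vanishes unless the sources of the first current lie in `T`. [folklore] -/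
theorem cpairSum_eq_zero_of_not_subset_left (β : ℝ) {T X Y : Finset V} (E₂ : Finset (Sym2 V)) (h : ¬X ⊆ T)
    (F : (edgesIn G Λ → ℕ) → ℝ≥0∞) : cpairSum G Λ β (edgesIn G T) E₂ X Y F = 0 := by
  unfold cpairSum
  refine ENNReal.tsum_eq_zero.2 fun p => ?_
  rw [ind_of_false, zero_mul, zero_mul]
  rintro ⟨hsrc, hs⟩
  exact h (hsrc ▸ csources_subset_of_csupp hs)

/-- The outer factor vanishes unless the sources of its first current lie in `Λ ∖ S`. [folklore] -/
theorem outerPairSum_eq_zero_of_not_subset (β : ℝ) {S : Finset V} (b : V) {X₂ Y₂ : Finset V}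
    (h : ¬X₂ ⊆ Λ \ S) (H : (edgesIn G Λ → ℕ) → ℝ≥0∞) : outerPairSum G Λ β S b X₂ Y₂ H = 0 := by
  unfold outerPairSum
  refine ENNReal.tsum_eq_zero.2 fun q => ?_
  by_cases hq : CSupp G Λ (edgesIn G (Λ \ S)) q.1 ∧ CSupp G Λ (edgesIn G (Λ \ S)) q.2
  · rw [ind_of_false (show ¬csources G Λ q.1 = X₂ from fun hsrc => h (hsrc ▸ csources_subset_of_csupp hq.1)),
      zero_mul, zero_mul, mul_zero]
  · rw [ind_of_false hq, zero_mul]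

/-- `Z_{ℰ_S}(A) < ∞` for `S ⊆ Λ` and `β ≥ 0`. [folklore] -/
theorem currentZ_edgesIn_ne_top {β : ℝ} (hβ : 0 ≤ β) {S : Finset V} (hS : S ⊆ Λ) (A : Finset V) :
    currentZ G Λ β (edgesIn G S) A ≠ ∞ := by
  rw [currentZ_edgesIn_eq G Λ hβ hS]
  exact ENNReal.ofReal_ne_top

/-- `Z_{ℰ_S}(A)` as a real number. [folklore] -/
theorem toReal_currentZ_edgesIn {β : ℝ} (hβ : 0 ≤ β) {S : Finset V} (hS : S ⊆ Λ) (A : Finset V) :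
    (currentZ G Λ β (edgesIn G S) A).toReal = Real.cosh β ^ #(edgesIn G S) * hteSum G S (Real.tanh β) A := by
  rw [currentZ_edgesIn_eq G Λ hβ hS, ENNReal.toReal_ofReal]
  exact mul_nonneg (pow_nonneg (Real.cosh_pos β).le _) (hteSum_nonneg G S (tanh_nonneg hβ) A)

/-- `Z_{ℰ_S}(∅) > 0` as a real number. [folklore] -/
theorem toReal_currentZ_edgesIn_empty_pos {β : ℝ} (hβ : 0 ≤ β) {S : Finset V} (hS : S ⊆ Λ) :
    0 < (currentZ G Λ β (edgesIn G S) ∅).toReal := by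
  rw [toReal_currentZ_edgesIn hβ hS]
  exact mul_pos (pow_pos (Real.cosh_pos β) _) (hteSum_empty_pos G S β)

/-- `Z_{ℰ_S}(∅) ≠ 0`. [folklore] -/
theorem currentZ_edgesIn_empty_ne_zero {β : ℝ} (hβ : 0 ≤ β) {S : Finset V} (hS : S ⊆ Λ) :
    currentZ G Λ β (edgesIn G S) ∅ ≠ 0 := fun h => by
  have := toReal_currentZ_edgesIn_empty_pos (G := G) hβ hS
  rw [h, ENNReal.toReal_zero] at this
  exact lt_irrefl 0 this

/-- **The random-current representation of free zero-field correlations in a sub-volume**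
(Duminil-Copin 2016, §2.2.1 with Remark 3.4; Tasaki–Hara 2015, (A.83)): for `A ⊆ S ⊆ Λ` and
`β ≥ 0`, `⟨σ_A⟩^∅_{S;β,0} = Z_{ℰ_S}(A) / Z_{ℰ_S}(∅)`. [cite: TasakiHara2015, Appendix A, eq. (A.83)] -/
theorem isingCorr_free_eq_currentZ_div {β : ℝ} (hβ : 0 ≤ β) {S : Finset V} (hS : S ⊆ Λ) {A : Finset V}
    (hA : A ⊆ S) :
    isingCorr G S β 0 .free A =
      (currentZ G Λ β (edgesIn G S) A).toReal / (currentZ G Λ β (edgesIn G S) ∅).toReal := by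
  rw [toReal_currentZ_edgesIn hβ hS, toReal_currentZ_edgesIn hβ hS, isingCorr_free_eq_hteSum_div G S β hA,
    mul_div_mul_left _ _ (pow_pos (Real.cosh_pos β) _).ne']

/-- The same, cross-multiplied: `⟨σ_A⟩^∅_{S} · Z_{ℰ_S}(∅) = Z_{ℰ_S}(A)`. [cite: TasakiHara2015, Appendix A, eq. (A.83)] -/
theorem isingCorr_free_mul_currentZ {β : ℝ} (hβ : 0 ≤ β) {S : Finset V} (hS : S ⊆ Λ) {A : Finset V}
    (hA : A ⊆ S) :
    isingCorr G S β 0 .free A * (currentZ G Λ β (edgesIn G S) ∅).toReal =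
      (currentZ G Λ β (edgesIn G S) A).toReal := by
  rw [isingCorr_free_eq_currentZ_div hβ hS hA, div_mul_cancel₀ _ (toReal_currentZ_edgesIn_empty_pos hβ hS).ne']

/-- **Griffiths' volume monotonicity in current form**: for `A ⊆ S ⊆ Λ` and `β ≥ 0`,
`Z_{ℰ_S}(A) Z_Λ(∅) ≤ Z_Λ(A) Z_{ℰ_S}(∅)`, i.e. `⟨σ_A⟩^∅_S ≤ ⟨σ_A⟩^∅_Λ` (Friedli–Velenik 2017,
Exercise 3.12, from GKS II; the step "`⟨σ_{x₂}σ_v⟩_{Λ∖B} ≤ ⟨σ_{x₂}σ_v⟩_Λ`" of Tasaki–Hara 2015,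
(A.151)). [cite: TasakiHara2015, Appendix A, proof of Theorem A.18, eq. (A.151)] -/
theorem currentZ_mul_currentZ_le_of_subset {β : ℝ} (hβ : 0 ≤ β) {S : Finset V} (hS : S ⊆ Λ) {A : Finset V}
    (hA : A ⊆ S) :
    currentZ G Λ β (edgesIn G S) A * currentZ G Λ β (edgesIn G Λ) ∅ ≤
      currentZ G Λ β (edgesIn G Λ) A * currentZ G Λ β (edgesIn G S) ∅ := by
  have hmono : isingCorr G S β 0 .free A ≤ isingCorr G Λ β 0 .free A :=
    isingCorr_free_mono_volume_of_gks G (fun G' _ Λ A B β h bc => GKSInequalities.gks_two_holds G')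
      hβ le_rfl hA hS
  rw [isingCorr_free_eq_currentZ_div hβ hS hA, isingCorr_free_eq_currentZ_div hβ subset_rfl (hA.trans hS),
    div_le_div_iff₀ (toReal_currentZ_edgesIn_empty_pos hβ hS) (toReal_currentZ_edgesIn_empty_pos hβ subset_rfl),
    ← ENNReal.toReal_mul, ← ENNReal.toReal_mul,
    ENNReal.toReal_le_toReal (ENNReal.mul_ne_top (currentZ_edgesIn_ne_top hβ hS A)
      (currentZ_edgesIn_ne_top hβ subset_rfl ∅))
      (ENNReal.mul_ne_top (currentZ_edgesIn_ne_top hβ subset_rfl A) (currentZ_edgesIn_ne_top hβ hS ∅))] at hmono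
  exact hmono

/-! ### Bookkeeping: symmetric differences of singletons, orientation of connections -/

/-- Membership in `{a} ∆ {b}`. [folklore] -/
theorem mem_singleton_symmDiff_singleton {a b y : V} :
    y ∈ ({a} ∆ {b} : Finset V) ↔ (y = a ∧ ¬y = b) ∨ (y = b ∧ ¬y = a) := by
  rw [mem_symmDiff, mem_singleton, mem_singleton]

/-- `{a} ∆ {b} ⊆ T` when `a, b ∈ T`. [folklore] -/
theorem singleton_symmDiff_singleton_subset {a b : V} {T : Finset V} (ha : a ∈ T) (hb : b ∈ T) :
    ({a} ∆ {b} : Finset V) ⊆ T :=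
  symmDiff_le_sup.trans (sup_le (singleton_subset_iff.2 ha) (singleton_subset_iff.2 hb))

/-- `{a} ∆ {b} ⊆ T` forces `b ∈ T` when `a ∈ T` (unless `a = b`). [folklore] -/
theorem mem_of_singleton_symmDiff_singleton_subset {a b : V} {T : Finset V} (h : ({a} ∆ {b} : Finset V) ⊆ T)
    (ha : a ∈ T) : b ∈ T := by
  by_cases hab : b = a
  · rw [hab]; exact ha
  · exact h (mem_singleton_symmDiff_singleton.2 (Or.inr ⟨rfl, hab⟩))

/-- `(A₁₂ ∆ A₃₄) ∆ A₂₄ = A₁₃`. [folklore] -/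
theorem symmDiff_four_symmDiff_pair₂₄ (x₁ x₂ x₃ x₄ : V) :
    ((({x₁} ∆ {x₂}) ∆ ({x₃} ∆ {x₄})) ∆ ({x₂} ∆ {x₄}) : Finset V) = {x₁} ∆ {x₃} := by
  ext y; simp only [mem_symmDiff, mem_singleton]; tauto

/-- `(A₁₂ ∆ A₃₄) ∆ A₁₄ = A₂₃`. [folklore] -/
theorem symmDiff_four_symmDiff_pair₁₄ (x₁ x₂ x₃ x₄ : V) :
    ((({x₁} ∆ {x₂}) ∆ ({x₃} ∆ {x₄})) ∆ ({x₁} ∆ {x₄}) : Finset V) = {x₂} ∆ {x₃} := by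
  ext y; simp only [mem_symmDiff, mem_singleton]; tauto

/-- `(A₁₂ ∆ A₃₄) ∆ A₃₄ = A₁₂`. [folklore] -/
theorem symmDiff_four_symmDiff_pair₃₄ (x₁ x₂ x₃ x₄ : V) :
    ((({x₁} ∆ {x₂}) ∆ ({x₃} ∆ {x₄})) ∆ ({x₃} ∆ {x₄}) : Finset V) = {x₁} ∆ {x₂} := by
  ext y; simp only [mem_symmDiff, mem_singleton]; tauto

/-- `A₂₄ ∆ ({x₄} ∆ {v}) = {x₂} ∆ {v}`. [folklore] -/
theorem symmDiff_pair_symmDiff_pair' (x₂ x₄ v : V) :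
    (({x₂} ∆ {x₄}) ∆ ({x₄} ∆ {v}) : Finset V) = {x₂} ∆ {v} := by
  ext y; simp only [mem_symmDiff, mem_singleton]; tauto

/-- The connection indicator is symmetric. [folklore] -/
theorem ind_cconn_comm (m : edgesIn G Λ → ℕ) (E' : Finset (Sym2 V)) (u v : V) :
    ind (CConn G Λ m E' u v) = ind (CConn G Λ m E' v u) :=
  ind_congr ⟨CConn.symm, CConn.symm⟩

/-- The non-connection indicator is symmetric. [folklore] -/
theorem ind_not_cconn_comm (m : edgesIn G Λ → ℕ) (E' : Finset (Sym2 V)) (u v : V) :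
    ind (¬CConn G Λ m E' u v) = ind (¬CConn G Λ m E' v u) :=
  ind_congr (not_congr ⟨CConn.symm, CConn.symm⟩)

/-! ### Step 1: `Z² ⟨σ₁σ₂;σ₃σ₄⟩` and `Z² U₄` as pair sums ((A.134)–(A.136)) -/

variable (G Λ) in
/-- **`Z(A₁₂∆A₃₄) Z(∅) = Z(A₁₂) Z(A₃₄) + ∑_{∂n₁ = A₁₂∆A₃₄, ∂n₂ = ∅} w w 𝟙[x₃ ↮ x₄]`**, i.e.
`Z² ⟨σ₁σ₂;σ₃σ₄⟩ = ∑_{∂n₁ = {x₁,x₂,x₃,x₄}, ∂n₂ = ∅} w w 𝟙[x₃ ↮ x₄]` (Tasaki–Hara 2015, (A.135): the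
random-current representation and the switching lemma). [cite: TasakiHara2015, Appendix A, proof of Theorem A.18, eq. (A.135)] -/
theorem currentZ_four_mul_currentZ_empty_eq {β : ℝ} (hβ : 0 ≤ β) (x₁ x₂ x₃ x₄ : V) :
    currentZ G Λ β (edgesIn G Λ) (({x₁} ∆ {x₂}) ∆ ({x₃} ∆ {x₄})) * currentZ G Λ β (edgesIn G Λ) ∅ =
      currentZ G Λ β (edgesIn G Λ) ({x₁} ∆ {x₂}) * currentZ G Λ β (edgesIn G Λ) ({x₃} ∆ {x₄}) +
        cpairSum G Λ β (edgesIn G Λ) (edgesIn G Λ) (({x₁} ∆ {x₂}) ∆ ({x₃} ∆ {x₄})) ∅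
          (fun m => ind (¬CConn G Λ m (edgesIn G Λ) x₃ x₄)) := by
  rw [← cpairSum_one, ← cpairSum_one, cpairSum_pair_eq_pairSum_empty_conn G Λ hβ subset_rfl ({x₁} ∆ {x₂}) x₃ x₄,
    ← cpairSum_add]
  refine cpairSum_congr fun n₁ n₂ _ _ _ _ => ?_
  rw [one_mul, ind_add_ind_not]

variable (G Λ) in
/-- **Splitting `∑_{∂n₁ = {x₁,x₂,x₃,x₄}, ∂n₂ = ∅} w w 𝟙[x₃ ↮ x₄]` according to which of `x₁, x₂` is
joined to `x₄`, and switching back** (Tasaki–Hara 2015, (A.136)):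
`= ∑_{∂n₁ = A₁₃, ∂n₂ = A₂₄} w w 𝟙[x₃ ↮ x₄] + ∑_{∂n₁ = A₂₃, ∂n₂ = A₁₄} w w 𝟙[x₃ ↮ x₄]`. [cite: TasakiHara2015, Appendix A, proof of Theorem A.18, eq. (A.136)] -/
theorem cpairSum_four_notConn_eq_add {β : ℝ} (hβ : 0 ≤ β) (x₁ x₂ x₃ x₄ : V) :
    cpairSum G Λ β (edgesIn G Λ) (edgesIn G Λ) (({x₁} ∆ {x₂}) ∆ ({x₃} ∆ {x₄})) ∅
        (fun m => ind (¬CConn G Λ m (edgesIn G Λ) x₃ x₄)) =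
      cpairSum G Λ β (edgesIn G Λ) (edgesIn G Λ) ({x₁} ∆ {x₃}) ({x₂} ∆ {x₄})
          (fun m => ind (¬CConn G Λ m (edgesIn G Λ) x₃ x₄)) +
        cpairSum G Λ β (edgesIn G Λ) (edgesIn G Λ) ({x₂} ∆ {x₃}) ({x₁} ∆ {x₄})
          (fun m => ind (¬CConn G Λ m (edgesIn G Λ) x₃ x₄)) := by
  set F : (edgesIn G Λ → ℕ) → ℝ≥0∞ := fun m => ind (¬CConn G Λ m (edgesIn G Λ) x₃ x₄) with hF
  -- the two switched sums, with their (automatic) connection indicators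
  have h1 : cpairSum G Λ β (edgesIn G Λ) (edgesIn G Λ) ({x₁} ∆ {x₃}) ({x₂} ∆ {x₄}) F =
      cpairSum G Λ β (edgesIn G Λ) (edgesIn G Λ) (({x₁} ∆ {x₂}) ∆ ({x₃} ∆ {x₄})) ∅
        (fun m => F m * ind (CConn G Λ m (edgesIn G Λ) x₂ x₄)) := by
    rw [← cpairSum_conn_eq_of_sources_right G Λ β _ _ _ x₂ x₄ F, cpairSum_switching G Λ hβ subset_rfl,
      symmDiff_self]
    congr 1
    rw [← symmDiff_four_symmDiff_pair₂₄ x₁ x₂ x₃ x₄, symmDiff_symmDiff_cancel_right]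
  have h2 : cpairSum G Λ β (edgesIn G Λ) (edgesIn G Λ) ({x₂} ∆ {x₃}) ({x₁} ∆ {x₄}) F =
      cpairSum G Λ β (edgesIn G Λ) (edgesIn G Λ) (({x₁} ∆ {x₂}) ∆ ({x₃} ∆ {x₄})) ∅
        (fun m => F m * ind (CConn G Λ m (edgesIn G Λ) x₁ x₄)) := by
    rw [← cpairSum_conn_eq_of_sources_right G Λ β _ _ _ x₁ x₄ F, cpairSum_switching G Λ hβ subset_rfl,
      symmDiff_self]
    congr 1
    rw [← symmDiff_four_symmDiff_pair₁₄ x₁ x₂ x₃ x₄, symmDiff_symmDiff_cancel_right]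
  rw [h1, h2, ← cpairSum_add]
  refine cpairSum_congr fun n₁ n₂ hsrc _ _ _ => ?_
  simp only [hF]
  by_cases hc : CConn G Λ (n₁ + n₂) (edgesIn G Λ) x₃ x₄
  · rw [ind_of_false (not_not.2 hc), zero_mul, zero_mul, zero_add]
  · have hx : CConn G Λ (n₁ + n₂) (edgesIn G Λ) x₄ x₁ ↔ ¬CConn G Λ (n₁ + n₂) (edgesIn G Λ) x₄ x₂ :=
      cconn_iff_not_cconn_of_csources_eq (fun e => Nat.le_add_right _ _) hsrc fun h => hc h.symm
    rw [ind_of_true hc, one_mul, one_mul, ind_cconn_comm _ _ x₂ x₄, ind_cconn_comm _ _ x₁ x₄]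
    by_cases h41 : CConn G Λ (n₁ + n₂) (edgesIn G Λ) x₄ x₁
    · rw [ind_of_true h41, ind_of_false (hx.1 h41), zero_add]
    · rw [ind_of_false h41, ind_of_true (by rwa [hx, not_not] at h41), add_zero]

variable (G Λ) in
/-- `Z(X) Z(Y) = ∑_{∂n₁ = X, ∂n₂ = Y} w w 𝟙[x₃ ↔ x₄] + ∑_{∂n₁ = X, ∂n₂ = Y} w w 𝟙[x₃ ↮ x₄]`. [folklore] -/
theorem currentZ_mul_currentZ_eq_pairSum_conn_add (β : ℝ) (X Y : Finset V) (x₃ x₄ : V) :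
    currentZ G Λ β (edgesIn G Λ) X * currentZ G Λ β (edgesIn G Λ) Y =
      cpairSum G Λ β (edgesIn G Λ) (edgesIn G Λ) X Y (fun m => ind (CConn G Λ m (edgesIn G Λ) x₃ x₄)) +
        cpairSum G Λ β (edgesIn G Λ) (edgesIn G Λ) X Y (fun m => ind (¬CConn G Λ m (edgesIn G Λ) x₃ x₄)) := by
  rw [← cpairSum_one, ← cpairSum_add]
  exact cpairSum_congr fun n₁ n₂ _ _ _ _ => (ind_add_ind_not _).symm

variable (G Λ) in
/-- **`Z² U₄` as a pair sum** (Tasaki–Hara 2015, (A.134)):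
`Z(A)Z(∅) + ∑_{A₁₃,A₂₄} w w 𝟙[x₃ ↔ x₄] + ∑_{A₂₃,A₁₄} w w 𝟙[x₃ ↔ x₄] = Z(A₁₂)Z(A₃₄) + Z(A₁₃)Z(A₂₄) + Z(A₂₃)Z(A₁₄)`,
i.e. `Z² U₄(x₁,x₂,x₃,x₄) = -∑_{∂n₁ = A₁₃, ∂n₂ = A₂₄} w w 𝟙[x₃ ↔ x₄] - ∑_{∂n₁ = A₂₃, ∂n₂ = A₁₄} w w 𝟙[x₃ ↔ x₄]`. [cite: TasakiHara2015, Appendix A, proof of Theorem A.18, eq. (A.134)] -/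
theorem currentZ_ursell_identity {β : ℝ} (hβ : 0 ≤ β) (x₁ x₂ x₃ x₄ : V) :
    currentZ G Λ β (edgesIn G Λ) (({x₁} ∆ {x₂}) ∆ ({x₃} ∆ {x₄})) * currentZ G Λ β (edgesIn G Λ) ∅ +
        cpairSum G Λ β (edgesIn G Λ) (edgesIn G Λ) ({x₁} ∆ {x₃}) ({x₂} ∆ {x₄})
          (fun m => ind (CConn G Λ m (edgesIn G Λ) x₃ x₄)) +
        cpairSum G Λ β (edgesIn G Λ) (edgesIn G Λ) ({x₂} ∆ {x₃}) ({x₁} ∆ {x₄})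
          (fun m => ind (CConn G Λ m (edgesIn G Λ) x₃ x₄)) =
      currentZ G Λ β (edgesIn G Λ) ({x₁} ∆ {x₂}) * currentZ G Λ β (edgesIn G Λ) ({x₃} ∆ {x₄}) +
        currentZ G Λ β (edgesIn G Λ) ({x₁} ∆ {x₃}) * currentZ G Λ β (edgesIn G Λ) ({x₂} ∆ {x₄}) +
        currentZ G Λ β (edgesIn G Λ) ({x₂} ∆ {x₃}) * currentZ G Λ β (edgesIn G Λ) ({x₁} ∆ {x₄}) := by
  rw [currentZ_four_mul_currentZ_empty_eq G Λ hβ, cpairSum_four_notConn_eq_add G Λ hβ,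
    currentZ_mul_currentZ_eq_pairSum_conn_add G Λ β ({x₁} ∆ {x₃}) ({x₂} ∆ {x₄}) x₃ x₄,
    currentZ_mul_currentZ_eq_pairSum_conn_add G Λ β ({x₂} ∆ {x₃}) ({x₁} ∆ {x₄}) x₃ x₄]
  ring

/-! ### More bookkeeping -/

/-- The pair sum of the zero functional vanishes. [folklore] -/
theorem cpairSum_zero_fun (β : ℝ) (E₁ E₂ : Finset (Sym2 V)) (X Y : Finset V) :
    cpairSum G Λ β E₁ E₂ X Y (fun _ => 0) = 0 := by
  unfold cpairSum
  exact ENNReal.tsum_eq_zero.2 fun p => by rw [mul_zero, mul_zero]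

/-- A pair sum whose functional vanishes on the prescribed currents vanishes. [folklore] -/
theorem cpairSum_eq_zero_of_forall {β : ℝ} {E₁ E₂ : Finset (Sym2 V)} {X Y : Finset V}
    {F : (edgesIn G Λ → ℕ) → ℝ≥0∞}
    (h : ∀ n₁ n₂, csources G Λ n₁ = X → CSupp G Λ E₁ n₁ → csources G Λ n₂ = Y → CSupp G Λ E₂ n₂ →
      F (n₁ + n₂) = 0) :
    cpairSum G Λ β E₁ E₂ X Y F = 0 := by
  rw [← cpairSum_zero_fun (G := G) (Λ := Λ) β E₁ E₂ X Y]
  exact cpairSum_congr h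

/-- `∑_{S ∈ T} 𝟙[c = S] f(S) = 𝟙[c ∈ T] f(c)`. [folklore] -/
theorem sum_ind_eq_mul_eq {α : Type*} [DecidableEq α] (T : Finset α) (c : α) (f : α → ℝ≥0∞) :
    ∑ S ∈ T, ind (c = S) * f S = ind (c ∈ T) * f c := by
  by_cases hc : c ∈ T
  · rw [sum_eq_single c (fun S _ hS => by rw [ind_of_false fun h => hS h.symm, zero_mul])
      (fun h => absurd hc h), ind_of_true rfl, ind_of_true hc]
  · rw [ind_of_false hc, zero_mul]
    exact sum_eq_zero fun S hS => by rw [ind_of_false (show ¬c = S from fun h => hc (h ▸ hS)), zero_mul]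

/-- `𝟙[P] x = if P then x else 0`. [folklore] -/
theorem ind_mul_eq_ite (P : Prop) [Decidable P] (x : ℝ≥0∞) : ind P * x = if P then x else 0 := by
  by_cases h : P
  · rw [ind_of_true h, one_mul, if_pos h]
  · rw [ind_of_false h, zero_mul, if_neg h]

/-- Filtering a subset of `S` by membership in `S`. [folklore] -/
theorem filter_mem_eq_self_of_subset {A S : Finset V} (h : A ⊆ S) : A.filter (· ∈ S) = A :=
  filter_true_of_mem fun _ ha => h ha

/-- Filtering a subset of `S` by non-membership in `S`. [folklore] -/
theorem filter_not_mem_eq_empty_of_subset {A S : Finset V} (h : A ⊆ S) : A.filter (· ∉ S) = ∅ :=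
  filter_false_of_mem fun _ ha => not_not.2 (h ha)

/-- Filtering a set disjoint from `S` by membership in `S`. [folklore] -/
theorem filter_mem_eq_empty_of_forall {A S : Finset V} (h : ∀ a ∈ A, a ∉ S) : A.filter (· ∈ S) = ∅ :=
  filter_false_of_mem h

/-- Filtering a set disjoint from `S` by non-membership in `S`. [folklore] -/
theorem filter_not_mem_eq_self_of_forall {A S : Finset V} (h : ∀ a ∈ A, a ∉ S) : A.filter (· ∉ S) = A :=
  filter_true_of_mem h

/-- Every element of `{a} ∆ {b}` is `a` or `b`. [folklore] -/
theorem eq_or_eq_of_mem_singleton_symmDiff {a b y : V} (h : y ∈ ({a} ∆ {b} : Finset V)) : y = a ∨ y = b := by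
  rcases mem_singleton_symmDiff_singleton.1 h with h | h
  · exact Or.inl h.1
  · exact Or.inr h.1

/-! ### Step 2: `∑_{∂n₁ = A_{uv} ∆ A₃₄, ∂n₂ = ∅} w w 𝟙[x₃ ↮ x₄] = R₃₄(u,v) + R₄₃(u,v)` ((A.133)) -/

variable (G Λ) in
/-- The quantity `R_{a,b}(u,v) = ∑_{S ⊆ Λ : a,u ∉ S; b,v ∈ S} Z_S({b}∆{v}) Z_S(∅) Ψ^{a}_S({a}∆{u}, ∅)`:
the decomposed form of `∑_{∂n₁ = {a}∆{u}, ∂n₂ = ∅} w w ⟨σ_bσ_v⟩_{Λ ∖ C_{n₁+n₂}(a)}` (the right-hand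
side of Tasaki–Hara 2015, (A.133) for `⟨σ_uσ_v ; σ_aσ_b⟩`, one of its two terms, and the last
factor of (A.151)), the cluster `C(a)` being conditioned to be `Λ ∖ S`. [cite: TasakiHara2015, Appendix A, proof of Theorem A.18, eqs. (A.133) and (A.151)] -/
def agR (β : ℝ) (a b u v : V) : ℝ≥0∞ :=
  ∑ S ∈ Λ.powerset.filter (fun S => a ∉ S ∧ u ∉ S ∧ b ∈ S ∧ v ∈ S),
    currentZ G Λ β (edgesIn G S) ({b} ∆ {v}) * currentZ G Λ β (edgesIn G S) ∅ *
      outerPairSum G Λ β S a ({a} ∆ {u}) ∅ (fun _ => 1)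

variable (G Λ) in
/-- **Conditioning on the cluster of `a`** (Tasaki–Hara 2015, Lemma A.19 as used for (A.133)): for
`u, v, a, b ∈ Λ`,
`∑_{∂n₁ = ({u}∆{v})∆({a}∆{b}), ∂n₂ = ∅} w w 𝟙[a ↮ b] 𝟙[a ↔ u] 𝟙[a ↮ v] = R_{a,b}(u,v)`. [cite: TasakiHara2015, Appendix A, Lemma A.19 and eq. (A.133)] -/
theorem cpairSum_four_first_eq_agR (β : ℝ) {u v a b : V} (hu : u ∈ Λ) (hv : v ∈ Λ) (ha : a ∈ Λ) (hb : b ∈ Λ) :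
    cpairSum G Λ β (edgesIn G Λ) (edgesIn G Λ) (({u} ∆ {v}) ∆ ({a} ∆ {b})) ∅
        (fun m => ind (¬CConn G Λ m (edgesIn G Λ) a b) * ind (CConn G Λ m (edgesIn G Λ) a u) *
          ind (¬CConn G Λ m (edgesIn G Λ) a v)) =
      agR G Λ β a b u v := by
  set A : Finset V := ({u} ∆ {v}) ∆ ({a} ∆ {b}) with hA
  set P : Finset V → Prop := fun S => a ∉ S ∧ u ∉ S ∧ b ∈ S ∧ v ∈ S with hP
  -- the functional as a function of the cluster complement of `a`
  have hfun : (fun m : edgesIn G Λ → ℕ => ind (¬CConn G Λ m (edgesIn G Λ) a b) *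
      ind (CConn G Λ m (edgesIn G Λ) a u) * ind (¬CConn G Λ m (edgesIn G Λ) a v)) =
      fun m => (fun S (_ : edgesIn G Λ → ℕ) => ind (P S)) (clusterCompl G Λ m a) m := by
    funext m
    rw [← ind_and, ← ind_and]
    refine ind_congr ?_
    simp only [hP, mem_clusterCompl]
    have haa : CConn G Λ m (edgesIn G Λ) a a := Relation.ReflTransGen.refl
    tauto
  have hstep : cpairSum G Λ β (edgesIn G Λ) (edgesIn G Λ) A ∅
      (fun m => ind (¬CConn G Λ m (edgesIn G Λ) a b) * ind (CConn G Λ m (edgesIn G Λ) a u) *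
        ind (¬CConn G Λ m (edgesIn G Λ) a v)) =
      ∑ S ∈ Λ.powerset, cpairSum G Λ β (edgesIn G Λ) (edgesIn G Λ) A ∅
        (fun m => ind (clusterCompl G Λ m a = S) * ind (P S)) := by
    rw [hfun]
    exact cpairSum_eq_sum_powerset_clusterCompl β A ∅ a (fun S _ => ind (P S))
  rw [hstep]
  -- pull out the constant indicator and restrict the sum
  have hterm : ∀ S ∈ Λ.powerset, cpairSum G Λ β (edgesIn G Λ) (edgesIn G Λ) A ∅
      (fun m => ind (clusterCompl G Λ m a = S) * ind (P S)) =
      if P S then cpairSum G Λ β (edgesIn G Λ) (edgesIn G Λ) A ∅ (fun m => ind (clusterCompl G Λ m a = S)) else 0 := by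
    intro S _
    classical
    rw [← ind_mul_eq_ite, ← cpairSum_mul_left]
    exact cpairSum_congr fun n₁ n₂ _ _ _ _ => by ring
  rw [sum_congr rfl hterm, ← sum_filter]
  unfold agR
  refine sum_congr rfl fun S hS => ?_
  obtain ⟨hSΛ, haS, huS, hbS, hvS⟩ : S ⊆ Λ ∧ a ∉ S ∧ u ∉ S ∧ b ∈ S ∧ v ∈ S := by
    simpa [hP, mem_filter, mem_powerset] using hS
  have hfac := cpairSum_clusterCompl_eq (G := G) β hSΛ (mem_sdiff.2 ⟨ha, haS⟩) A ∅ (fun _ => 1) (fun _ => 1)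
  simp only [mul_one] at hfac
  rw [hfac, filter_empty, filter_empty, cpairSum_one]
  have h1 : A.filter (· ∈ S) = {b} ∆ {v} := by
    ext y; simp only [hA, mem_filter, mem_symmDiff, mem_singleton]
    constructor
    · rintro ⟨h, hy⟩
      rcases h with ⟨h1 | h1, h2⟩ | ⟨h1 | h1, h2⟩
      · exact absurd hy (h1.1 ▸ huS)
      · refine Or.inr ⟨h1.1, fun hyb => h2 (Or.inr ⟨hyb, fun hya => haS (hya ▸ hy)⟩)⟩
      · exact absurd hy (h1.1 ▸ haS)
      · refine Or.inl ⟨h1.1, fun hyv => h2 (Or.inr ⟨hyv, fun hyu => huS (hyu ▸ hy)⟩)⟩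
    · rintro (⟨hyb, hyv⟩ | ⟨hyv, hyb⟩)
      · refine ⟨Or.inr ⟨Or.inr ⟨hyb, fun hya => haS (hya ▸ hyb ▸ hbS)⟩, ?_⟩, hyb ▸ hbS⟩
        rintro (⟨hyu, -⟩ | ⟨hyv', -⟩)
        · exact huS (hyu ▸ hyb ▸ hbS)
        · exact hyv hyv'
      · refine ⟨Or.inl ⟨Or.inr ⟨hyv, fun hyu => huS (hyu ▸ hyv ▸ hvS)⟩, ?_⟩, hyv ▸ hvS⟩
        rintro (⟨hya, -⟩ | ⟨hyb', -⟩)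
        · exact haS (hya ▸ hyv ▸ hvS)
        · exact hyb hyb'
  have h2 : A.filter (· ∉ S) = {a} ∆ {u} := by
    ext y; simp only [hA, mem_filter, mem_symmDiff, mem_singleton]
    constructor
    · rintro ⟨h, hy⟩
      rcases h with ⟨h1 | h1, h2⟩ | ⟨h1 | h1, h2⟩
      · refine Or.inr ⟨h1.1, fun hya => h2 (Or.inl ⟨hya, fun hyb => hy (hyb ▸ hbS)⟩)⟩
      · exact absurd (h1.1 ▸ hvS) hy
      · refine Or.inl ⟨h1.1, fun hyu => h2 (Or.inl ⟨hyu, fun hyv => hy (hyv ▸ hvS)⟩)⟩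
      · exact absurd (h1.1 ▸ hbS) hy
    · rintro (⟨hya, hyu⟩ | ⟨hyu, hya⟩)
      · refine ⟨Or.inr ⟨Or.inl ⟨hya, fun hyb => haS (hya ▸ hyb ▸ hbS)⟩, ?_⟩, hya ▸ haS⟩
        rintro (⟨hyu', -⟩ | ⟨hyv, -⟩)
        · exact hyu hyu'
        · exact haS (hya ▸ hyv ▸ hvS)
      · refine ⟨Or.inl ⟨Or.inl ⟨hyu, fun hyv => huS (hyu ▸ hyv ▸ hvS)⟩, ?_⟩, hyu ▸ huS⟩
        rintro (⟨hya', -⟩ | ⟨hyb, -⟩)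
        · exact hya hya'
        · exact huS (hyu ▸ hyb ▸ hbS)
  rw [h1, h2]

variable (G Λ) in
/-- **`∑_{∂n₁ = {u}∆{v}∆{x₃}∆{x₄}, ∂n₂ = ∅} w w 𝟙[x₃ ↮ x₄] = R₃₄(u,v) + R₄₃(u,v)`**, i.e.
`Z² ⟨σ_uσ_v ; σ₃σ₄⟩ = R₃₄(u,v) + R₄₃(u,v)`: on `{x₃ ↮ x₄}` exactly one of `u, v` is joined to `x₃`
(and then the other to `x₄`); condition on the cluster of `x₃`, resp. of `x₄` (Tasaki–Hara 2015,
(A.133) with (A.135)–(A.136)). [cite: TasakiHara2015, Appendix A, proof of Theorem A.18, eq. (A.133)] -/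
theorem cpairSum_four_notConn_eq_agR_add (β : ℝ) {u v x₃ x₄ : V} (hu : u ∈ Λ) (hv : v ∈ Λ)
    (hx₃ : x₃ ∈ Λ) (hx₄ : x₄ ∈ Λ) :
    cpairSum G Λ β (edgesIn G Λ) (edgesIn G Λ) (({u} ∆ {v}) ∆ ({x₃} ∆ {x₄})) ∅
        (fun m => ind (¬CConn G Λ m (edgesIn G Λ) x₃ x₄)) =
      agR G Λ β x₃ x₄ u v + agR G Λ β x₄ x₃ u v := by
  rw [← cpairSum_four_first_eq_agR G Λ β hu hv hx₃ hx₄, ← cpairSum_four_first_eq_agR G Λ β hu hv hx₄ hx₃,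
    symmDiff_comm ({x₄} : Finset V) {x₃}, ← cpairSum_add]
  refine cpairSum_congr fun n₁ n₂ hsrc _ _ _ => ?_
  set m := n₁ + n₂ with hm
  have hle : n₁ ≤ m := fun e => Nat.le_add_right _ _
  by_cases h34 : CConn G Λ m (edgesIn G Λ) x₃ x₄
  · rw [ind_of_false (not_not.2 h34), ind_of_false (not_not.2 h34.symm), zero_mul,
      zero_mul, zero_mul, zero_mul, zero_add]
  · have h43 : ¬CConn G Λ m (edgesIn G Λ) x₄ x₃ := fun h => h34 h.symm
    -- parity at `x₃` and at `x₄`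
    have hsrc' : csources G Λ n₁ = ({u} ∆ {v}) ∆ ({x₄} ∆ {x₃}) := by rw [hsrc, symmDiff_comm ({x₃} : Finset V)]
    have hxor₃ : CConn G Λ m (edgesIn G Λ) x₃ u ↔ ¬CConn G Λ m (edgesIn G Λ) x₃ v :=
      cconn_iff_not_cconn_of_csources_eq hle hsrc' h34
    have hxor₄ : CConn G Λ m (edgesIn G Λ) x₄ u ↔ ¬CConn G Λ m (edgesIn G Λ) x₄ v :=
      cconn_iff_not_cconn_of_csources_eq hle hsrc h43
    rw [ind_of_true h34, ind_of_true h43, one_mul, one_mul]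
    by_cases h3u : CConn G Λ m (edgesIn G Λ) x₃ u
    · have h3v : ¬CConn G Λ m (edgesIn G Λ) x₃ v := hxor₃.1 h3u
      have h4u : ¬CConn G Λ m (edgesIn G Λ) x₄ u := fun h => h34 (h3u.trans h.symm)
      rw [ind_of_true h3u, ind_of_true h3v, ind_of_false h4u, one_mul, zero_mul, add_zero]
    · have h3v : CConn G Λ m (edgesIn G Λ) x₃ v := by rwa [hxor₃, not_not] at h3u
      have h4v : ¬CConn G Λ m (edgesIn G Λ) x₄ v := fun h => h34 (h3v.trans h.symm)
      have h4u : CConn G Λ m (edgesIn G Λ) x₄ u := by rwa [hxor₄]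
      rw [ind_of_false h3u, ind_of_true h4u, ind_of_true h4v, zero_mul, zero_add, one_mul]

/-- **`Z² ⟨σ_uσ_v ; σ₃σ₄⟩ = R₃₄(u,v) + R₄₃(u,v)`** (Tasaki–Hara 2015, (A.133)), in the form
`Z(A_{uv}∆A₃₄) Z(∅) = Z(A_{uv}) Z(A₃₄) + R₃₄(u,v) + R₄₃(u,v)`. [cite: TasakiHara2015, Appendix A, proof of Theorem A.18, eq. (A.133)] -/
theorem currentZ_four_mul_currentZ_empty_eq_agR {β : ℝ} (hβ : 0 ≤ β) {u v x₃ x₄ : V} (hu : u ∈ Λ)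
    (hv : v ∈ Λ) (hx₃ : x₃ ∈ Λ) (hx₄ : x₄ ∈ Λ) :
    currentZ G Λ β (edgesIn G Λ) (({u} ∆ {v}) ∆ ({x₃} ∆ {x₄})) * currentZ G Λ β (edgesIn G Λ) ∅ =
      currentZ G Λ β (edgesIn G Λ) ({u} ∆ {v}) * currentZ G Λ β (edgesIn G Λ) ({x₃} ∆ {x₄}) +
        (agR G Λ β x₃ x₄ u v + agR G Λ β x₄ x₃ u v) := by
  rw [currentZ_four_mul_currentZ_empty_eq G Λ hβ, cpairSum_four_notConn_eq_agR_add G Λ β hu hv hx₃ hx₄]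

/-! ### Step 3: the bound on `∑_{∂n₁ = A₁₃, ∂n₂ = A₂₄} w w 𝟙[x₃ ↔ x₄]` ((A.145)–(A.151)) -/

/-- Undoing a conditioning: `∑_{∂n₁ = X, ∂n₂ = Y} w w 𝟙[𝒮_b = S]` factorised (the case
`H₁ = H₂ = 1` of `cpairSum_clusterCompl_eq`). [cite: TasakiHara2015, Appendix A, Lemma A.19, eqs. (A.127)–(A.132)] -/
theorem cpairSum_ind_clusterCompl_eq (β : ℝ) {S : Finset V} (hS : S ⊆ Λ) {b : V} (hb : b ∈ Λ \ S)
    (X Y : Finset V) :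
    cpairSum G Λ β (edgesIn G Λ) (edgesIn G Λ) X Y (fun m => ind (clusterCompl G Λ m b = S)) =
      currentZ G Λ β (edgesIn G S) (X.filter (· ∈ S)) * currentZ G Λ β (edgesIn G S) (Y.filter (· ∈ S)) *
        outerPairSum G Λ β S b (X.filter (· ∉ S)) (Y.filter (· ∉ S)) (fun _ => 1) := by
  have h := cpairSum_clusterCompl_eq (G := G) β hS hb X Y (fun _ => 1) (fun _ => 1)
  simp only [mul_one] at h
  rw [h, cpairSum_one]

/-- `∑_{S ∈ T} ∑_{∂n₁ = X, ∂n₂ = Y} w w 𝟙[𝒮_b = S] f(S) = ∑ w w 𝟙[𝒮_b ∈ T] f(𝒮_b)`. [folklore] -/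
theorem sum_cpairSum_ind_clusterCompl_eq (β : ℝ) (X Y : Finset V) (b : V) (T : Finset (Finset V))
    (f : Finset V → ℝ≥0∞) :
    ∑ S ∈ T, cpairSum G Λ β (edgesIn G Λ) (edgesIn G Λ) X Y (fun m => ind (clusterCompl G Λ m b = S) * f S) =
      cpairSum G Λ β (edgesIn G Λ) (edgesIn G Λ) X Y
        (fun m => ind (clusterCompl G Λ m b ∈ T) * f (clusterCompl G Λ m b)) := by
  rw [← cpairSum_finset_sum]
  exact cpairSum_congr fun n₁ n₂ _ _ _ _ => sum_ind_eq_mul_eq T _ f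

variable (G Λ) in
/-- **The terms with `x₃ ∉ 𝒮_{x₄}` resum to `Z(A₁₃) Z(A₄₃) Z(A₂₃)`** (Tasaki–Hara 2015, (A.146):
"`C₄ ∋ x₃` means `x₃ ↔ x₄`, so switching the sources gives `⟨13⟩⟨23⟩⟨43⟩`"):
`∑_{∂n₁ = ∅, ∂n₂ = A₂₄} w w 𝟙[x₄ ↔ x₃] = Z({x₄}∆{x₃}) Z({x₂}∆{x₃})`. [cite: TasakiHara2015, Appendix A, proof of Theorem A.18, eq. (A.146)] -/
theorem cpairSum_empty_pair_conn_eq {β : ℝ} (hβ : 0 ≤ β) (E : Finset (Sym2 V)) (x₂ x₃ x₄ : V) :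
    cpairSum G Λ β E E ∅ ({x₂} ∆ {x₄}) (fun m => ind (CConn G Λ m E x₄ x₃)) =
      currentZ G Λ β E ({x₄} ∆ {x₃}) * currentZ G Λ β E ({x₂} ∆ {x₃}) := by
  have h := cpairSum_switching G Λ hβ (subset_rfl : E ⊆ E) ∅ ({x₂} ∆ {x₄}) x₄ x₃ (fun _ => 1)
  simp only [one_mul] at h
  rw [h, ← Finset.bot_eq_empty, bot_symmDiff, symmDiff_pair_symmDiff_pair',
    ← cpairSum_one]
  have h' := cpairSum_conn_eq_of_sources_left G Λ β E E ({x₂} ∆ {x₃}) x₄ x₃ (fun _ => 1)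
  simp only [one_mul] at h'
  exact h'

variable (G Λ) [DecidableRel G.Adj] in
/-- **Step 3 on the event `{𝒮_{x₄} = S}` with `x₃ ∈ S`** (Tasaki–Hara 2015, (A.142)–(A.145) inside the
conditioning of (A.134)): for `S ⊆ Λ` with `x₃ ∈ S`,
`Z(A₁₃) ∑_{∅, A₂₄} w w 𝟙[𝒮₄ = S] ≤ Z(∅) ∑_{A₁₃, A₂₄} w w 𝟙[𝒮₄ = S]`
`  + tanh β ∑_{u ∼ v} Z({v}∆{x₁}) 𝟙[u ∈ S, v ∉ S] ∑_{∂n₁ = {x₃}∆{u}, ∂n₂ = A₂₄} w w 𝟙[𝒮₄ = S]`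
(factorise on the event, apply the generalised modified Simon inequality
`currentZ_mul_currentZ_le_add` to `Z_Λ(A₁₃) Z_S(∅)`, and refactorise). [cite: TasakiHara2015, Appendix A, proof of Theorem A.18, eqs. (A.142)–(A.145)] -/
theorem currentZ_mul_cpairSum_ind_clusterCompl_le {β : ℝ} (hβ : 0 ≤ β) {x₁ x₂ x₃ x₄ : V} (hx₄ : x₄ ∈ Λ)
    {S : Finset V} (hS : S ⊆ Λ) (hx₃S : x₃ ∈ S) :
    currentZ G Λ β (edgesIn G Λ) ({x₁} ∆ {x₃}) *
        cpairSum G Λ β (edgesIn G Λ) (edgesIn G Λ) ∅ ({x₂} ∆ {x₄}) (fun m => ind (clusterCompl G Λ m x₄ = S)) ≤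
      currentZ G Λ β (edgesIn G Λ) ∅ *
          cpairSum G Λ β (edgesIn G Λ) (edgesIn G Λ) ({x₁} ∆ {x₃}) ({x₂} ∆ {x₄})
            (fun m => ind (clusterCompl G Λ m x₄ = S)) +
        ENNReal.ofReal (Real.tanh β) * ∑ u ∈ Λ, ∑ v ∈ Λ.filter (G.Adj u),
          currentZ G Λ β (edgesIn G Λ) ({v} ∆ {x₁}) *
            (ind (u ∈ S ∧ v ∉ S) * cpairSum G Λ β (edgesIn G Λ) (edgesIn G Λ) ({x₃} ∆ {u}) ({x₂} ∆ {x₄})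
              (fun m => ind (clusterCompl G Λ m x₄ = S))) := by
  by_cases hx₄S : x₄ ∈ S
  · -- the event is empty
    have h0 : cpairSum G Λ β (edgesIn G Λ) (edgesIn G Λ) ∅ ({x₂} ∆ {x₄})
        (fun m => ind (clusterCompl G Λ m x₄ = S)) = 0 :=
      cpairSum_eq_zero_of_forall fun n₁ n₂ _ _ _ _ =>
        ind_of_false fun h => not_mem_clusterCompl_self (n₁ + n₂) x₄ (h ▸ hx₄S)
    rw [h0, mul_zero]
    exact zero_le
  have hb : x₄ ∈ Λ \ S := mem_sdiff.2 ⟨hx₄, hx₄S⟩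
  set A₂₄' : Finset V := ({x₂} ∆ {x₄} : Finset V).filter (· ∈ S) with hA₂₄'
  set Out : ℝ≥0∞ := outerPairSum G Λ β S x₄ ∅ (({x₂} ∆ {x₄} : Finset V).filter (· ∉ S)) (fun _ => 1)
    with hOut
  have hfac₀ := cpairSum_ind_clusterCompl_eq (G := G) β hS hb ∅ ({x₂} ∆ {x₄})
  rw [filter_empty, filter_empty, ← hA₂₄', ← hOut] at hfac₀
  -- the generalised modified Simon inequality on `Z_Λ(A₁₃) Z_S(∅)`
  have hkey := currentZ_mul_currentZ_le_add G Λ hβ hS (x₁ := x₁) hx₃S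
  calc currentZ G Λ β (edgesIn G Λ) ({x₁} ∆ {x₃}) *
        cpairSum G Λ β (edgesIn G Λ) (edgesIn G Λ) ∅ ({x₂} ∆ {x₄}) (fun m => ind (clusterCompl G Λ m x₄ = S))
      = (currentZ G Λ β (edgesIn G Λ) ({x₁} ∆ {x₃}) * currentZ G Λ β (edgesIn G S) ∅) *
          (currentZ G Λ β (edgesIn G S) A₂₄' * Out) := by
        rw [hfac₀]; ring
    _ ≤ (currentZ G Λ β (edgesIn G S) ({x₁} ∆ {x₃}) * currentZ G Λ β (edgesIn G Λ) ∅ +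
          ∑ u ∈ S, ∑ v ∈ (Λ \ S).filter (G.Adj u),
            ENNReal.ofReal (Real.tanh β) * currentZ G Λ β (edgesIn G Λ) ({v} ∆ {x₁}) *
              currentZ G Λ β (edgesIn G S) ({x₃} ∆ {u})) *
          (currentZ G Λ β (edgesIn G S) A₂₄' * Out) := mul_le_mul_left hkey _
    _ = currentZ G Λ β (edgesIn G Λ) ∅ *
          (currentZ G Λ β (edgesIn G S) ({x₁} ∆ {x₃}) * currentZ G Λ β (edgesIn G S) A₂₄' * Out) +
        ENNReal.ofReal (Real.tanh β) * ∑ u ∈ S, ∑ v ∈ (Λ \ S).filter (G.Adj u),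
          currentZ G Λ β (edgesIn G Λ) ({v} ∆ {x₁}) *
            (currentZ G Λ β (edgesIn G S) ({x₃} ∆ {u}) * currentZ G Λ β (edgesIn G S) A₂₄' * Out) := by
        rw [add_mul, sum_mul, mul_sum]
        congr 1
        · ring
        · refine sum_congr rfl fun u _ => ?_
          rw [sum_mul, mul_sum]
          exact sum_congr rfl fun v _ => by ring
    _ ≤ _ := add_le_add ?_ ?_
  · -- the first piece is (at most) the conditioned pair sum with sources `A₁₃, A₂₄`
    refine mul_le_mul_right ?_ _
    rw [cpairSum_ind_clusterCompl_eq β hS hb, ← hA₂₄']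
    by_cases hx₁S : x₁ ∈ S
    · have hsub : ({x₁} ∆ {x₃} : Finset V) ⊆ S := singleton_symmDiff_singleton_subset hx₁S hx₃S
      rw [filter_mem_eq_self_of_subset hsub, filter_not_mem_eq_empty_of_subset hsub, ← hOut]
    · have hnot : ¬({x₁} ∆ {x₃} : Finset V) ⊆ S := fun h =>
        hx₁S (h (mem_singleton_symmDiff_singleton.2 (Or.inl ⟨rfl, fun h13 => hx₁S (h13 ▸ hx₃S)⟩)))
      rw [currentZ_eq_zero_of_not_subset β hnot, zero_mul, zero_mul]
      exact zero_le
  · -- the second piece: refactorise each term and enlarge the range of `(u, v)`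
    refine mul_le_mul_right ?_ _
    calc ∑ u ∈ S, ∑ v ∈ (Λ \ S).filter (G.Adj u), currentZ G Λ β (edgesIn G Λ) ({v} ∆ {x₁}) *
            (currentZ G Λ β (edgesIn G S) ({x₃} ∆ {u}) * currentZ G Λ β (edgesIn G S) A₂₄' * Out)
        = ∑ u ∈ S, ∑ v ∈ (Λ \ S).filter (G.Adj u), currentZ G Λ β (edgesIn G Λ) ({v} ∆ {x₁}) *
            (ind (u ∈ S ∧ v ∉ S) * cpairSum G Λ β (edgesIn G Λ) (edgesIn G Λ) ({x₃} ∆ {u}) ({x₂} ∆ {x₄})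
              (fun m => ind (clusterCompl G Λ m x₄ = S))) := by
          refine sum_congr rfl fun u hu => sum_congr rfl fun v hv => ?_
          have hvS : v ∉ S := (mem_sdiff.1 (mem_filter.1 hv).1).2
          have hsub : ({x₃} ∆ {u} : Finset V) ⊆ S := singleton_symmDiff_singleton_subset hx₃S hu
          rw [ind_of_true ⟨hu, hvS⟩, one_mul, cpairSum_ind_clusterCompl_eq β hS hb,
            filter_mem_eq_self_of_subset hsub, filter_not_mem_eq_empty_of_subset hsub, ← hA₂₄', ← hOut]
      _ ≤ ∑ u ∈ Λ, ∑ v ∈ (Λ \ S).filter (G.Adj u), currentZ G Λ β (edgesIn G Λ) ({v} ∆ {x₁}) *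
            (ind (u ∈ S ∧ v ∉ S) * cpairSum G Λ β (edgesIn G Λ) (edgesIn G Λ) ({x₃} ∆ {u}) ({x₂} ∆ {x₄})
              (fun m => ind (clusterCompl G Λ m x₄ = S))) :=
          sum_le_sum_of_subset hS
      _ ≤ _ := sum_le_sum fun u _ => sum_le_sum_of_subset (filter_subset_filter _ sdiff_subset)

/-- `𝟙[P] ≠ 0` iff `P`. [folklore] -/
theorem ind_ne_zero_iff (P : Prop) : ind P ≠ 0 ↔ P := by
  by_cases h : P
  · rw [ind_of_true h]; exact ⟨fun _ => h, fun _ => one_ne_zero⟩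
  · rw [ind_of_false h]; exact ⟨fun h' => absurd rfl h', fun h' => absurd h' h⟩

variable (G Λ) [DecidableRel G.Adj] in
/-- **Step 3, summed over the value of `𝒮_{x₄}`** (Tasaki–Hara 2015, (A.145)–(A.146)): for
`x₂, x₃, x₄ ∈ Λ`,
`Z(A₁₃) Z(∅) Z(A₂₄) ≤ Z(∅) ∑_{A₁₃, A₂₄} w w 𝟙[x₃ ↮ x₄] + tanh β ∑_{u ∼ v} Z({v}∆{x₁}) Q(u,v) + Z(A₁₃) Z({x₄}∆{x₃}) Z({x₂}∆{x₃})`,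
where `Q(u,v) = ∑_{∂n₁ = {x₃}∆{u}, ∂n₂ = A₂₄} w w 𝟙[x₄ ↮ x₃] 𝟙[x₄ ↮ u] 𝟙[x₄ ↔ v]` (the sum of (A.145),
first term, before the change of conditioning). [cite: TasakiHara2015, Appendix A, proof of Theorem A.18, eqs. (A.145)–(A.146)] -/
theorem currentZ_pair_mul_le_notConn_add {β : ℝ} (hβ : 0 ≤ β) {x₁ x₂ x₃ x₄ : V} (hx₃ : x₃ ∈ Λ) (hx₄ : x₄ ∈ Λ) :
    currentZ G Λ β (edgesIn G Λ) ({x₁} ∆ {x₃}) *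
        (currentZ G Λ β (edgesIn G Λ) ∅ * currentZ G Λ β (edgesIn G Λ) ({x₂} ∆ {x₄})) ≤
      currentZ G Λ β (edgesIn G Λ) ∅ *
          cpairSum G Λ β (edgesIn G Λ) (edgesIn G Λ) ({x₁} ∆ {x₃}) ({x₂} ∆ {x₄})
            (fun m => ind (¬CConn G Λ m (edgesIn G Λ) x₃ x₄)) +
        ENNReal.ofReal (Real.tanh β) * ∑ u ∈ Λ, ∑ v ∈ Λ.filter (G.Adj u),
          currentZ G Λ β (edgesIn G Λ) ({v} ∆ {x₁}) *
            cpairSum G Λ β (edgesIn G Λ) (edgesIn G Λ) ({x₃} ∆ {u}) ({x₂} ∆ {x₄})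
              (fun m => ind (¬CConn G Λ m (edgesIn G Λ) x₄ x₃) * ind (¬CConn G Λ m (edgesIn G Λ) x₄ u) *
                ind (CConn G Λ m (edgesIn G Λ) x₄ v)) +
        currentZ G Λ β (edgesIn G Λ) ({x₁} ∆ {x₃}) *
          (currentZ G Λ β (edgesIn G Λ) ({x₄} ∆ {x₃}) * currentZ G Λ β (edgesIn G Λ) ({x₂} ∆ {x₃})) := by
  set EΛ := edgesIn G Λ with hEΛ
  set T : Finset (Finset V) := Λ.powerset.filter (fun S => x₃ ∈ S) with hT
  set T' : Finset (Finset V) := Λ.powerset.filter (fun S => x₃ ∉ S) with hT'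
  -- decomposition of `Z(∅) Z(A₂₄)` over the value of `𝒮_{x₄}`
  have hdec : currentZ G Λ β EΛ ∅ * currentZ G Λ β EΛ ({x₂} ∆ {x₄}) =
      ∑ S ∈ Λ.powerset, cpairSum G Λ β EΛ EΛ ∅ ({x₂} ∆ {x₄}) (fun m => ind (clusterCompl G Λ m x₄ = S)) := by
    rw [← cpairSum_one]
    have h := cpairSum_eq_sum_powerset_clusterCompl (G := G) (Λ := Λ) β ∅ ({x₂} ∆ {x₄}) x₄ (fun _ _ => 1)
    simp only [mul_one] at h
    exact h
  -- membership of `𝒮_{x₄}(m)` in `T`, `T'`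
  have hmemT : ∀ m : EΛ → ℕ, clusterCompl G Λ m x₄ ∈ T ↔ ¬CConn G Λ m EΛ x₃ x₄ := by
    intro m
    simp only [hT, mem_filter, mem_powerset, mem_clusterCompl]
    exact ⟨fun h h' => h.2.2 h'.symm, fun h => ⟨clusterCompl_subset m x₄, hx₃, fun h' => h h'.symm⟩⟩
  have hmemT' : ∀ m : EΛ → ℕ, clusterCompl G Λ m x₄ ∈ T' ↔ CConn G Λ m EΛ x₄ x₃ := by
    intro m
    simp only [hT', mem_filter, mem_powerset, mem_clusterCompl, not_and, not_not]
    exact ⟨fun h => h.2 hx₃, fun h => ⟨clusterCompl_subset m x₄, fun _ => h⟩⟩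
  -- Part A: `x₃ ∉ S`
  have hA : ∑ S ∈ T', currentZ G Λ β EΛ ({x₁} ∆ {x₃}) *
      cpairSum G Λ β EΛ EΛ ∅ ({x₂} ∆ {x₄}) (fun m => ind (clusterCompl G Λ m x₄ = S)) =
      currentZ G Λ β EΛ ({x₁} ∆ {x₃}) * (currentZ G Λ β EΛ ({x₄} ∆ {x₃}) * currentZ G Λ β EΛ ({x₂} ∆ {x₃})) := by
    rw [← mul_sum, ← cpairSum_empty_pair_conn_eq G Λ hβ EΛ x₂ x₃ x₄]
    congr 1
    have h := sum_cpairSum_ind_clusterCompl_eq (G := G) (Λ := Λ) β ∅ ({x₂} ∆ {x₄}) x₄ T' (fun _ => 1)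
    simp only [mul_one] at h
    rw [h]
    exact cpairSum_congr fun n₁ n₂ _ _ _ _ => ind_congr (hmemT' _)
  -- Part B: `x₃ ∈ S`
  have hB : ∑ S ∈ T, currentZ G Λ β EΛ ({x₁} ∆ {x₃}) *
      cpairSum G Λ β EΛ EΛ ∅ ({x₂} ∆ {x₄}) (fun m => ind (clusterCompl G Λ m x₄ = S)) ≤
      currentZ G Λ β EΛ ∅ *
          cpairSum G Λ β EΛ EΛ ({x₁} ∆ {x₃}) ({x₂} ∆ {x₄}) (fun m => ind (¬CConn G Λ m EΛ x₃ x₄)) +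
        ENNReal.ofReal (Real.tanh β) * ∑ u ∈ Λ, ∑ v ∈ Λ.filter (G.Adj u),
          currentZ G Λ β EΛ ({v} ∆ {x₁}) *
            cpairSum G Λ β EΛ EΛ ({x₃} ∆ {u}) ({x₂} ∆ {x₄})
              (fun m => ind (¬CConn G Λ m EΛ x₄ x₃) * ind (¬CConn G Λ m EΛ x₄ u) *
                ind (CConn G Λ m EΛ x₄ v)) := by
    calc ∑ S ∈ T, currentZ G Λ β EΛ ({x₁} ∆ {x₃}) *
          cpairSum G Λ β EΛ EΛ ∅ ({x₂} ∆ {x₄}) (fun m => ind (clusterCompl G Λ m x₄ = S))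
        ≤ ∑ S ∈ T, (currentZ G Λ β EΛ ∅ *
              cpairSum G Λ β EΛ EΛ ({x₁} ∆ {x₃}) ({x₂} ∆ {x₄}) (fun m => ind (clusterCompl G Λ m x₄ = S)) +
            ENNReal.ofReal (Real.tanh β) * ∑ u ∈ Λ, ∑ v ∈ Λ.filter (G.Adj u),
              currentZ G Λ β EΛ ({v} ∆ {x₁}) *
                (ind (u ∈ S ∧ v ∉ S) * cpairSum G Λ β EΛ EΛ ({x₃} ∆ {u}) ({x₂} ∆ {x₄})
                  (fun m => ind (clusterCompl G Λ m x₄ = S)))) :=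
          sum_le_sum fun S hS => currentZ_mul_cpairSum_ind_clusterCompl_le G Λ hβ hx₄ (mem_powerset.1 (mem_filter.1 hS).1) (mem_filter.1 hS).2
      _ = currentZ G Λ β EΛ ∅ * ∑ S ∈ T,
              cpairSum G Λ β EΛ EΛ ({x₁} ∆ {x₃}) ({x₂} ∆ {x₄}) (fun m => ind (clusterCompl G Λ m x₄ = S)) +
            ENNReal.ofReal (Real.tanh β) * ∑ u ∈ Λ, ∑ v ∈ Λ.filter (G.Adj u),
              currentZ G Λ β EΛ ({v} ∆ {x₁}) * ∑ S ∈ T,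
                (ind (u ∈ S ∧ v ∉ S) * cpairSum G Λ β EΛ EΛ ({x₃} ∆ {u}) ({x₂} ∆ {x₄})
                  (fun m => ind (clusterCompl G Λ m x₄ = S))) := by
          rw [sum_add_distrib, ← mul_sum, ← mul_sum]
          congr 1
          congr 1
          rw [sum_comm]
          refine sum_congr rfl fun u _ => ?_
          rw [sum_comm]
          refine sum_congr rfl fun v _ => ?_
          rw [mul_sum]
      _ ≤ _ := add_le_add ?_ ?_
    · -- `∑_{S ∈ T} 𝟙[𝒮₄ = S] = 𝟙[x₃ ∈ 𝒮₄] = 𝟙[x₃ ↮ x₄]`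
      refine mul_le_mul_right (le_of_eq ?_) _
      have h := sum_cpairSum_ind_clusterCompl_eq (G := G) (Λ := Λ) β ({x₁} ∆ {x₃}) ({x₂} ∆ {x₄}) x₄ T (fun _ => 1)
      simp only [mul_one] at h
      rw [h]
      exact cpairSum_congr fun n₁ n₂ _ _ _ _ => ind_congr (hmemT _)
    · refine mul_le_mul_right (sum_le_sum fun u hu => sum_le_sum fun v hv => mul_le_mul_right ?_ _) _
      have hvΛ : v ∈ Λ := (mem_filter.1 hv).1
      have h := sum_cpairSum_ind_clusterCompl_eq (G := G) (Λ := Λ) β ({x₃} ∆ {u}) ({x₂} ∆ {x₄}) x₄ T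
        (fun S => ind (u ∈ S ∧ v ∉ S))
      have h' : ∑ S ∈ T, ind (u ∈ S ∧ v ∉ S) * cpairSum G Λ β EΛ EΛ ({x₃} ∆ {u}) ({x₂} ∆ {x₄})
          (fun m => ind (clusterCompl G Λ m x₄ = S)) =
          ∑ S ∈ T, cpairSum G Λ β EΛ EΛ ({x₃} ∆ {u}) ({x₂} ∆ {x₄})
            (fun m => ind (clusterCompl G Λ m x₄ = S) * ind (u ∈ S ∧ v ∉ S)) := by
        refine sum_congr rfl fun S _ => ?_
        rw [← cpairSum_mul_left]
        exact cpairSum_congr fun n₁ n₂ _ _ _ _ => mul_comm _ _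
      rw [h', h]
      refine cpairSum_mono' fun m => ?_
      by_cases hm : clusterCompl G Λ m x₄ ∈ T ∧ (u ∈ clusterCompl G Λ m x₄ ∧ v ∉ clusterCompl G Λ m x₄)
      · obtain ⟨hmT, huS, hvS⟩ := hm
        have h43 : ¬CConn G Λ m EΛ x₄ x₃ := fun h => (hmemT m).1 hmT h.symm
        have h4u : ¬CConn G Λ m EΛ x₄ u := (mem_clusterCompl.1 huS).2
        have h4v : CConn G Λ m EΛ x₄ v := by
          by_contra h
          exact hvS (mem_clusterCompl.2 ⟨hvΛ, h⟩)
        rw [ind_of_true hmT, ind_of_true ⟨huS, hvS⟩, ind_of_true h43, ind_of_true h4u, ind_of_true h4v,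
          mul_one, mul_one]
      · rw [← ind_and, ind_of_false hm]
        exact zero_le
  rw [hdec, mul_sum, ← sum_filter_add_sum_filter_not Λ.powerset (fun S => x₃ ∈ S)]
  exact add_le_add hB hA.le

variable (G Λ) in
/-- **Step 3, the change of conditioning and Griffiths' inequality** (Tasaki–Hara 2015,
(A.147)–(A.151)): for `u, v, x₂, x₃, x₄ ∈ Λ`,
`Z(∅) ∑_{∂n₁ = {x₃}∆{u}, ∂n₂ = A₂₄} w w 𝟙[x₄ ↮ x₃] 𝟙[x₄ ↮ u] 𝟙[x₄ ↔ v] ≤ Z({x₂}∆{v}) R₃₄(u,v)`: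
condition on the cluster of `x₃` instead, switch `{x₄, v}` inside `S'` ((A.150)) and bound
`Z(∅) Z_{S'}({x₂}∆{v}) ≤ Z({x₂}∆{v}) Z_{S'}(∅)` ((A.151)). [cite: TasakiHara2015, Appendix A, proof of Theorem A.18, eqs. (A.147)–(A.151)] -/
theorem currentZ_empty_mul_agQ_le {β : ℝ} (hβ : 0 ≤ β) {u v x₂ x₃ x₄ : V}
    (hv : v ∈ Λ) (hx₂ : x₂ ∈ Λ) (hx₃ : x₃ ∈ Λ) (hx₄ : x₄ ∈ Λ) :
    currentZ G Λ β (edgesIn G Λ) ∅ *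
        cpairSum G Λ β (edgesIn G Λ) (edgesIn G Λ) ({x₃} ∆ {u}) ({x₂} ∆ {x₄})
          (fun m => ind (¬CConn G Λ m (edgesIn G Λ) x₄ x₃) * ind (¬CConn G Λ m (edgesIn G Λ) x₄ u) *
            ind (CConn G Λ m (edgesIn G Λ) x₄ v)) ≤
      currentZ G Λ β (edgesIn G Λ) ({x₂} ∆ {v}) * agR G Λ β x₃ x₄ u v := by
  set g : (edgesIn G Λ → ℕ) → ℝ≥0∞ := fun m => ind (¬CConn G Λ m (edgesIn G Λ) x₄ x₃) * ind (¬CConn G Λ m (edgesIn G Λ) x₄ u) *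
    ind (CConn G Λ m (edgesIn G Λ) x₄ v) with hg
  set P' : Finset V → Prop := fun S' => x₃ ∉ S' ∧ u ∉ S' ∧ x₄ ∈ S' ∧ v ∈ S' ∧ x₂ ∈ S' with hP'
  set smd : Finset V → ℝ≥0∞ := fun S' => currentZ G Λ β (edgesIn G S') ({x₄} ∆ {v}) *
    currentZ G Λ β (edgesIn G S') ∅ * outerPairSum G Λ β S' x₃ ({x₃} ∆ {u}) ∅ (fun _ => 1) with hsmd
  have hdec : cpairSum G Λ β (edgesIn G Λ) (edgesIn G Λ) ({x₃} ∆ {u}) ({x₂} ∆ {x₄}) g =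
      ∑ S' ∈ Λ.powerset, cpairSum G Λ β (edgesIn G Λ) (edgesIn G Λ) ({x₃} ∆ {u}) ({x₂} ∆ {x₄})
        (fun m => ind (clusterCompl G Λ m x₃ = S') * g m) :=
    cpairSum_eq_sum_powerset_clusterCompl (G := G) (Λ := Λ) β _ _ x₃ (fun _ m => g m)
  -- the terms vanish unless `P' S'`
  have hvanish : ∀ S', ¬P' S' → cpairSum G Λ β (edgesIn G Λ) (edgesIn G Λ) ({x₃} ∆ {u}) ({x₂} ∆ {x₄})
      (fun m => ind (clusterCompl G Λ m x₃ = S') * g m) = 0 := by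
    intro S' hnP
    refine cpairSum_eq_zero_of_forall fun n₁ n₂ h1 h1' h2 h2' => ?_
    by_contra hne
    obtain ⟨hS', hgm⟩ := mul_ne_zero_iff.1 hne
    rw [ind_ne_zero_iff] at hS'
    simp only [hg] at hgm
    obtain ⟨⟨h43, h4u⟩, h4v⟩ := mul_ne_zero_iff.1 hgm |>.imp (fun h => mul_ne_zero_iff.1 h) id
    rw [ind_ne_zero_iff] at h43 h4u h4v
    set m := n₁ + n₂
    have h3u : CConn G Λ m (edgesIn G Λ) x₃ u := (cconn_of_csources_eq_of_csupp h1 h1').mono fun e => Nat.le_add_right _ _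
    have h24 : CConn G Λ m (edgesIn G Λ) x₂ x₄ := (cconn_of_csources_eq_of_csupp h2 h2').mono fun e => Nat.le_add_left _ _
    apply hnP
    rw [← hS']
    refine ⟨not_mem_clusterCompl_self m x₃, fun h => (mem_clusterCompl.1 h).2 h3u,
      mem_clusterCompl.2 ⟨hx₄, fun h => h43 h.symm⟩,
      mem_clusterCompl.2 ⟨hv, fun h => h43 (h4v.trans h.symm)⟩,
      mem_clusterCompl.2 ⟨hx₂, fun h => h43 (CConn.symm (h.trans h24))⟩⟩
  -- the main bound on `{𝒮_{x₃} = S'}` with `P' S'`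
  have hmain : ∀ S' ∈ Λ.powerset, P' S' → currentZ G Λ β (edgesIn G Λ) ∅ *
      cpairSum G Λ β (edgesIn G Λ) (edgesIn G Λ) ({x₃} ∆ {u}) ({x₂} ∆ {x₄}) (fun m => ind (clusterCompl G Λ m x₃ = S') * g m) ≤
      currentZ G Λ β (edgesIn G Λ) ({x₂} ∆ {v}) * smd S' := by
    intro S' hS'𝒫 hP
    have hS' : S' ⊆ Λ := mem_powerset.1 hS'𝒫
    obtain ⟨h3, huS, h4, hvS, h2S⟩ := hP
    have hb3 : x₃ ∈ Λ \ S' := mem_sdiff.2 ⟨hx₃, h3⟩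
    set H₁ : (edgesIn G Λ → ℕ) → ℝ≥0∞ := fun a => ind (CConn G Λ a (edgesIn G S') x₄ v) with hH₁
    -- (a) bound the functional by one depending on the inner part only
    have ha : cpairSum G Λ β (edgesIn G Λ) (edgesIn G Λ) ({x₃} ∆ {u}) ({x₂} ∆ {x₄}) (fun m => ind (clusterCompl G Λ m x₃ = S') * g m) ≤
        cpairSum G Λ β (edgesIn G Λ) (edgesIn G Λ) ({x₃} ∆ {u}) ({x₂} ∆ {x₄}) (fun m => ind (clusterCompl G Λ m x₃ = S') *
          (H₁ (crestr G Λ (edgesIn G S') m) * (fun _ => (1 : ℝ≥0∞)) (crestr G Λ (edgesIn G (Λ \ S')) m))) := by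
      refine cpairSum_mono' fun m => ?_
      by_cases heq : clusterCompl G Λ m x₃ = S'
      · rw [ind_of_true heq, one_mul, one_mul, mul_one]
        simp only [hg, hH₁]
        rw [cconn_crestr_iff, ← cconn_iff_cconn_inner (csupp_cut_of_clusterCompl_eq heq) h4, mul_assoc]
        exact (ind_mul_le _ _).trans (ind_mul_le _ _)
      · rw [ind_of_false heq, zero_mul, zero_mul]
    -- (b) factorise and evaluate the inner pair sum by switching inside `S'`
    have hfilt₁ : ({x₃} ∆ {u} : Finset V).filter (· ∈ S') = ∅ :=
      filter_mem_eq_empty_of_forall fun y hy => (eq_or_eq_of_mem_singleton_symmDiff hy).elim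
        (fun h => h ▸ h3) (fun h => h ▸ huS)
    have hfilt₂ : ({x₃} ∆ {u} : Finset V).filter (· ∉ S') = {x₃} ∆ {u} :=
      filter_not_mem_eq_self_of_forall fun y hy => (eq_or_eq_of_mem_singleton_symmDiff hy).elim
        (fun h => h ▸ h3) (fun h => h ▸ huS)
    have hsub₂₄ : ({x₂} ∆ {x₄} : Finset V) ⊆ S' := singleton_symmDiff_singleton_subset h2S h4
    have hb : cpairSum G Λ β (edgesIn G Λ) (edgesIn G Λ) ({x₃} ∆ {u}) ({x₂} ∆ {x₄}) (fun m => ind (clusterCompl G Λ m x₃ = S') *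
          (H₁ (crestr G Λ (edgesIn G S') m) * (fun _ => (1 : ℝ≥0∞)) (crestr G Λ (edgesIn G (Λ \ S')) m))) =
        currentZ G Λ β (edgesIn G S') ({x₄} ∆ {v}) * currentZ G Λ β (edgesIn G S') ({x₂} ∆ {v}) *
          outerPairSum G Λ β S' x₃ ({x₃} ∆ {u}) ∅ (fun _ => 1) := by
      rw [cpairSum_clusterCompl_eq β hS' hb3 ({x₃} ∆ {u}) ({x₂} ∆ {x₄}) H₁ (fun _ => 1), hfilt₁, hfilt₂, filter_mem_eq_self_of_subset hsub₂₄,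
        filter_not_mem_eq_empty_of_subset hsub₂₄, hH₁, cpairSum_empty_pair_conn_eq G Λ hβ (edgesIn G S') x₂ v x₄]
    -- (c) Griffiths
    have hG := currentZ_mul_currentZ_le_of_subset (G := G) hβ hS' (singleton_symmDiff_singleton_subset h2S hvS)
    calc currentZ G Λ β (edgesIn G Λ) ∅ *
          cpairSum G Λ β (edgesIn G Λ) (edgesIn G Λ) ({x₃} ∆ {u}) ({x₂} ∆ {x₄}) (fun m => ind (clusterCompl G Λ m x₃ = S') * g m)
        ≤ currentZ G Λ β (edgesIn G Λ) ∅ * (currentZ G Λ β (edgesIn G S') ({x₄} ∆ {v}) *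
            currentZ G Λ β (edgesIn G S') ({x₂} ∆ {v}) * outerPairSum G Λ β S' x₃ ({x₃} ∆ {u}) ∅ (fun _ => 1)) := by
          rw [← hb]; exact mul_le_mul_right ha _
      _ = currentZ G Λ β (edgesIn G S') ({x₄} ∆ {v}) *
            (currentZ G Λ β (edgesIn G S') ({x₂} ∆ {v}) * currentZ G Λ β (edgesIn G Λ) ∅) *
              outerPairSum G Λ β S' x₃ ({x₃} ∆ {u}) ∅ (fun _ => 1) := by ring
      _ ≤ currentZ G Λ β (edgesIn G S') ({x₄} ∆ {v}) *
            (currentZ G Λ β (edgesIn G Λ) ({x₂} ∆ {v}) * currentZ G Λ β (edgesIn G S') ∅) *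
              outerPairSum G Λ β S' x₃ ({x₃} ∆ {u}) ∅ (fun _ => 1) := by gcongr
      _ = currentZ G Λ β (edgesIn G Λ) ({x₂} ∆ {v}) * smd S' := by simp only [hsmd]; ring
  -- summation
  classical
  calc currentZ G Λ β (edgesIn G Λ) ∅ * cpairSum G Λ β (edgesIn G Λ) (edgesIn G Λ) ({x₃} ∆ {u}) ({x₂} ∆ {x₄}) g
      = ∑ S' ∈ Λ.powerset, currentZ G Λ β (edgesIn G Λ) ∅ *
          cpairSum G Λ β (edgesIn G Λ) (edgesIn G Λ) ({x₃} ∆ {u}) ({x₂} ∆ {x₄}) (fun m => ind (clusterCompl G Λ m x₃ = S') * g m) := by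
        rw [hdec, mul_sum]
    _ ≤ ∑ S' ∈ Λ.powerset, if P' S' then currentZ G Λ β (edgesIn G Λ) ({x₂} ∆ {v}) * smd S' else 0 := by
        refine sum_le_sum fun S' hS' => ?_
        by_cases hP : P' S'
        · rw [if_pos hP]; exact hmain S' hS' hP
        · rw [if_neg hP, hvanish S' hP, mul_zero]
    _ = currentZ G Λ β (edgesIn G Λ) ({x₂} ∆ {v}) * ∑ S' ∈ Λ.powerset.filter P', smd S' := by
        rw [mul_sum, sum_filter]
    _ ≤ currentZ G Λ β (edgesIn G Λ) ({x₂} ∆ {v}) * agR G Λ β x₃ x₄ u v := by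
        refine mul_le_mul_right ?_ _
        unfold agR
        refine sum_le_sum_of_subset fun S' hS' => ?_
        simp only [hP', mem_filter] at hS' ⊢
        exact ⟨hS'.1, hS'.2.1, hS'.2.2.1, hS'.2.2.2.1, hS'.2.2.2.2.1⟩

variable (G Λ) [DecidableRel G.Adj] in
/-- **Step 3 assembled** (Tasaki–Hara 2015, (A.145)–(A.151)): for `x₂, x₃, x₄ ∈ Λ`,
`Z² ∑_{∂n₁ = A₁₃, ∂n₂ = A₂₄} w w 𝟙[x₃ ↔ x₄] ≤ tanh β ∑_{u ∼ v} Z({v}∆{x₁}) Z({x₂}∆{v}) R₃₄(u,v) + Z Z(A₁₃) Z({x₄}∆{x₃}) Z({x₂}∆{x₃})`. [cite: TasakiHara2015, Appendix A, proof of Theorem A.18, eqs. (A.145)–(A.151)] -/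
theorem cpairSum_pair_pair_conn_le {β : ℝ} (hβ : 0 ≤ β) {x₁ x₂ x₃ x₄ : V} (hx₂ : x₂ ∈ Λ) (hx₃ : x₃ ∈ Λ)
    (hx₄ : x₄ ∈ Λ) :
    currentZ G Λ β (edgesIn G Λ) ∅ * currentZ G Λ β (edgesIn G Λ) ∅ *
        cpairSum G Λ β (edgesIn G Λ) (edgesIn G Λ) ({x₁} ∆ {x₃}) ({x₂} ∆ {x₄})
          (fun m => ind (CConn G Λ m (edgesIn G Λ) x₃ x₄)) ≤
      ENNReal.ofReal (Real.tanh β) * ∑ u ∈ Λ, ∑ v ∈ Λ.filter (G.Adj u),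
          currentZ G Λ β (edgesIn G Λ) ({v} ∆ {x₁}) * currentZ G Λ β (edgesIn G Λ) ({x₂} ∆ {v}) *
            agR G Λ β x₃ x₄ u v +
        currentZ G Λ β (edgesIn G Λ) ∅ * (currentZ G Λ β (edgesIn G Λ) ({x₁} ∆ {x₃}) *
          (currentZ G Λ β (edgesIn G Λ) ({x₄} ∆ {x₃}) * currentZ G Λ β (edgesIn G Λ) ({x₂} ∆ {x₃}))) := by
  have hcore := currentZ_pair_mul_le_notConn_add G Λ hβ (x₁ := x₁) (x₂ := x₂) hx₃ hx₄
  have hsplit := currentZ_mul_currentZ_eq_pairSum_conn_add G Λ β ({x₁} ∆ {x₃}) ({x₂} ∆ {x₄}) x₃ x₄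
  set Z0 := currentZ G Λ β (edgesIn G Λ) ∅ with hZ0
  set Pc := cpairSum G Λ β (edgesIn G Λ) (edgesIn G Λ) ({x₁} ∆ {x₃}) ({x₂} ∆ {x₄})
    (fun m => ind (CConn G Λ m (edgesIn G Λ) x₃ x₄)) with hPc
  set Pn := cpairSum G Λ β (edgesIn G Λ) (edgesIn G Λ) ({x₁} ∆ {x₃}) ({x₂} ∆ {x₄})
    (fun m => ind (¬CConn G Λ m (edgesIn G Λ) x₃ x₄)) with hPn
  -- finiteness of the cancelled term
  have hPn_top : Z0 * Z0 * Pn ≠ ∞ := by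
    refine ENNReal.mul_ne_top (ENNReal.mul_ne_top (currentZ_edgesIn_ne_top hβ subset_rfl ∅)
      (currentZ_edgesIn_ne_top hβ subset_rfl ∅)) (ne_top_of_le_ne_top ?_ (cpairSum_le_currentZ_mul fun m => ind_le_one _))
    exact ENNReal.mul_ne_top (currentZ_edgesIn_ne_top hβ subset_rfl _) (currentZ_edgesIn_ne_top hβ subset_rfl _)
  -- `Z0 (tanh ∑∑ Z Q) ≤ tanh ∑∑ Z Z R`
  have hQ : Z0 * (ENNReal.ofReal (Real.tanh β) * ∑ u ∈ Λ, ∑ v ∈ Λ.filter (G.Adj u),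
      currentZ G Λ β (edgesIn G Λ) ({v} ∆ {x₁}) *
        cpairSum G Λ β (edgesIn G Λ) (edgesIn G Λ) ({x₃} ∆ {u}) ({x₂} ∆ {x₄})
          (fun m => ind (¬CConn G Λ m (edgesIn G Λ) x₄ x₃) * ind (¬CConn G Λ m (edgesIn G Λ) x₄ u) *
            ind (CConn G Λ m (edgesIn G Λ) x₄ v))) ≤
      ENNReal.ofReal (Real.tanh β) * ∑ u ∈ Λ, ∑ v ∈ Λ.filter (G.Adj u),
        currentZ G Λ β (edgesIn G Λ) ({v} ∆ {x₁}) * currentZ G Λ β (edgesIn G Λ) ({x₂} ∆ {v}) *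
          agR G Λ β x₃ x₄ u v := by
    rw [mul_left_comm, mul_sum]
    refine mul_le_mul_right (sum_le_sum fun u _ => ?_) _
    rw [mul_sum]
    refine sum_le_sum fun v hv => ?_
    have hvΛ : v ∈ Λ := (mem_filter.1 hv).1
    calc Z0 * (currentZ G Λ β (edgesIn G Λ) ({v} ∆ {x₁}) *
          cpairSum G Λ β (edgesIn G Λ) (edgesIn G Λ) ({x₃} ∆ {u}) ({x₂} ∆ {x₄})
            (fun m => ind (¬CConn G Λ m (edgesIn G Λ) x₄ x₃) * ind (¬CConn G Λ m (edgesIn G Λ) x₄ u) *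
              ind (CConn G Λ m (edgesIn G Λ) x₄ v)))
        = currentZ G Λ β (edgesIn G Λ) ({v} ∆ {x₁}) * (Z0 *
          cpairSum G Λ β (edgesIn G Λ) (edgesIn G Λ) ({x₃} ∆ {u}) ({x₂} ∆ {x₄})
            (fun m => ind (¬CConn G Λ m (edgesIn G Λ) x₄ x₃) * ind (¬CConn G Λ m (edgesIn G Λ) x₄ u) *
              ind (CConn G Λ m (edgesIn G Λ) x₄ v))) := by ring
      _ ≤ currentZ G Λ β (edgesIn G Λ) ({v} ∆ {x₁}) * (currentZ G Λ β (edgesIn G Λ) ({x₂} ∆ {v}) *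
          agR G Λ β x₃ x₄ u v) := mul_le_mul_right (currentZ_empty_mul_agQ_le G Λ hβ hvΛ hx₂ hx₃ hx₄) _
      _ = _ := by ring
  have hmain : Z0 * Z0 * Pn + Z0 * Z0 * Pc ≤ Z0 * Z0 * Pn +
      (ENNReal.ofReal (Real.tanh β) * ∑ u ∈ Λ, ∑ v ∈ Λ.filter (G.Adj u),
          currentZ G Λ β (edgesIn G Λ) ({v} ∆ {x₁}) * currentZ G Λ β (edgesIn G Λ) ({x₂} ∆ {v}) *
            agR G Λ β x₃ x₄ u v +
        Z0 * (currentZ G Λ β (edgesIn G Λ) ({x₁} ∆ {x₃}) *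
          (currentZ G Λ β (edgesIn G Λ) ({x₄} ∆ {x₃}) * currentZ G Λ β (edgesIn G Λ) ({x₂} ∆ {x₃})))) := by
    calc Z0 * Z0 * Pn + Z0 * Z0 * Pc
        = Z0 * (currentZ G Λ β (edgesIn G Λ) ({x₁} ∆ {x₃}) * (Z0 * currentZ G Λ β (edgesIn G Λ) ({x₂} ∆ {x₄}))) := by
          rw [show currentZ G Λ β (edgesIn G Λ) ({x₁} ∆ {x₃}) * (Z0 * currentZ G Λ β (edgesIn G Λ) ({x₂} ∆ {x₄})) =
            Z0 * (currentZ G Λ β (edgesIn G Λ) ({x₁} ∆ {x₃}) * currentZ G Λ β (edgesIn G Λ) ({x₂} ∆ {x₄})) by ring,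
            hsplit]
          ring
      _ ≤ Z0 * (Z0 * Pn + ENNReal.ofReal (Real.tanh β) * (∑ u ∈ Λ, ∑ v ∈ Λ.filter (G.Adj u),
            currentZ G Λ β (edgesIn G Λ) ({v} ∆ {x₁}) *
              cpairSum G Λ β (edgesIn G Λ) (edgesIn G Λ) ({x₃} ∆ {u}) ({x₂} ∆ {x₄})
                (fun m => ind (¬CConn G Λ m (edgesIn G Λ) x₄ x₃) * ind (¬CConn G Λ m (edgesIn G Λ) x₄ u) *
                  ind (CConn G Λ m (edgesIn G Λ) x₄ v))) +
            currentZ G Λ β (edgesIn G Λ) ({x₁} ∆ {x₃}) *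
              (currentZ G Λ β (edgesIn G Λ) ({x₄} ∆ {x₃}) * currentZ G Λ β (edgesIn G Λ) ({x₂} ∆ {x₃}))) :=
          mul_le_mul_right hcore _
      _ = Z0 * Z0 * Pn + (Z0 * (ENNReal.ofReal (Real.tanh β) * ∑ u ∈ Λ, ∑ v ∈ Λ.filter (G.Adj u),
            currentZ G Λ β (edgesIn G Λ) ({v} ∆ {x₁}) *
              cpairSum G Λ β (edgesIn G Λ) (edgesIn G Λ) ({x₃} ∆ {u}) ({x₂} ∆ {x₄})
                (fun m => ind (¬CConn G Λ m (edgesIn G Λ) x₄ x₃) * ind (¬CConn G Λ m (edgesIn G Λ) x₄ u) *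
                  ind (CConn G Λ m (edgesIn G Λ) x₄ v))) +
            Z0 * (currentZ G Λ β (edgesIn G Λ) ({x₁} ∆ {x₃}) *
              (currentZ G Λ β (edgesIn G Λ) ({x₄} ∆ {x₃}) * currentZ G Λ β (edgesIn G Λ) ({x₂} ∆ {x₃})))) := by
          ring
      _ ≤ _ := add_le_add le_rfl (add_le_add hQ le_rfl)
  exact (ENNReal.add_le_add_iff_left hPn_top).1 hmain

/-! ### Step 4: the Aizenman–Graham inequality -/

/-- `R_{a,b}(u,v) < ∞`. [folklore] -/
theorem agR_ne_top {β : ℝ} (hβ : 0 ≤ β) {u v a b : V} (hu : u ∈ Λ) (hv : v ∈ Λ) (ha : a ∈ Λ) (hb : b ∈ Λ) :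
    agR G Λ β a b u v ≠ ∞ := by
  have h := currentZ_four_mul_currentZ_empty_eq_agR (G := G) hβ hu hv ha hb
  have htop : currentZ G Λ β (edgesIn G Λ) (({u} ∆ {v}) ∆ ({a} ∆ {b})) * currentZ G Λ β (edgesIn G Λ) ∅ ≠ ∞ :=
    ENNReal.mul_ne_top (currentZ_edgesIn_ne_top (G := G) (Λ := Λ) hβ subset_rfl _)
      (currentZ_edgesIn_ne_top (G := G) (Λ := Λ) hβ subset_rfl _)
  refine ne_top_of_le_ne_top htop ?_
  rw [h]
  exact le_add_left le_self_add

/-- `⟨σ_xσ_y⟩ = ⟨σ_{{x}∆{y}}⟩` (`σ_xσ_y = σ_{{x}∆{y}}`). [folklore] -/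
theorem agTwoPoint_eq_isingCorr (Λ' : Finset V) (β h : ℝ) (bc : BoundaryCondition V) (x y : V) :
    isingTwoPoint G Λ' β h bc x y = isingCorr G Λ' β h bc ({x} ∆ {y}) := by
  rw [isingTwoPoint, spinPair_eq_spinProduct_symmDiff, ← isingCorr]

/-- `⟨σ_xσ_y⟩ = ⟨σ_{{y}∆{x}}⟩` (the symmetry `{x} ∆ {y} = {y} ∆ {x}`). [folklore] -/
theorem agTwoPoint_eq_isingCorr' (Λ' : Finset V) (β h : ℝ) (bc : BoundaryCondition V) (x y : V) :
    isingTwoPoint G Λ' β h bc x y = isingCorr G Λ' β h bc ({y} ∆ {x}) := by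
  rw [agTwoPoint_eq_isingCorr, symmDiff_comm]

variable (G Λ) [DecidableRel G.Adj] in
/-- **The Aizenman–Graham inequality** (Aizenman–Graham 1983; Tasaki–Hara 2015, Theorem A.18,
eq. (A.125), for the nearest-neighbour coupling `Ĵ_{u,v} = β 1_{u ∼ v}`, zero field, free boundary
condition). For the Ising model on a finite volume `Λ` of a locally finite graph at `β ≥ 0`, writing
`⟨·⟩ = ⟨·⟩^∅_{Λ;β,0}`, for all `x₁, x₂, x₃, x₄ ∈ Λ`:
`U₄(x₁,x₂,x₃,x₄) = ⟨σ₁σ₂σ₃σ₄⟩ - ⟨σ₁σ₂⟩⟨σ₃σ₄⟩ - ⟨σ₁σ₃⟩⟨σ₂σ₄⟩ - ⟨σ₁σ₄⟩⟨σ₂σ₃⟩`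
`  ≥ - ∑_{u,v ∈ Λ, u ∼ v} ⟨σ₁σ_v⟩⟨σ₂σ_v⟩ tanh β ⟨σ_uσ_v ; σ₃σ₄⟩ - ⟨σ₁σ₃⟩⟨σ₂σ₃⟩⟨σ₄σ₃⟩ - ⟨σ₁σ₄⟩⟨σ₂σ₄⟩⟨σ₃σ₄⟩`,
where `⟨σ_uσ_v ; σ₃σ₄⟩ = ⟨σ_uσ_vσ₃σ₄⟩ - ⟨σ_uσ_v⟩⟨σ₃σ₄⟩`, the sum runs over ordered adjacent pairs of
`Λ`, and products of spins at possibly coincident points are the spin products `σ_A` of the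
symmetric differences (`σ_x² = 1`). This is "the inequality complementary to Lebowitz'
inequality" used for `γ = 1` (ibid., Ch. 10, §3.3, eq. (10.65)). [cite: TasakiHara2015, Appendix A, Theorem A.18, eq. (A.125)] -/
theorem aizenmanGraham_inequality_isingCorr {β : ℝ} (hβ : 0 ≤ β) {x₁ x₂ x₃ x₄ : V} (hx₁ : x₁ ∈ Λ) (hx₂ : x₂ ∈ Λ)
    (hx₃ : x₃ ∈ Λ) (hx₄ : x₄ ∈ Λ) :
    -(Real.tanh β * ∑ u ∈ Λ, ∑ v ∈ Λ.filter (G.Adj u),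
          isingTwoPoint G Λ β 0 .free x₁ v * isingTwoPoint G Λ β 0 .free x₂ v *
            (isingCorr G Λ β 0 .free (({u} ∆ {v}) ∆ ({x₃} ∆ {x₄})) -
              isingTwoPoint G Λ β 0 .free u v * isingTwoPoint G Λ β 0 .free x₃ x₄)) -
        isingTwoPoint G Λ β 0 .free x₁ x₃ * isingTwoPoint G Λ β 0 .free x₂ x₃ *
          isingTwoPoint G Λ β 0 .free x₄ x₃ -
        isingTwoPoint G Λ β 0 .free x₁ x₄ * isingTwoPoint G Λ β 0 .free x₂ x₄ *
          isingTwoPoint G Λ β 0 .free x₃ x₄ ≤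
      isingCorr G Λ β 0 .free (({x₁} ∆ {x₂}) ∆ ({x₃} ∆ {x₄})) -
        isingTwoPoint G Λ β 0 .free x₁ x₂ * isingTwoPoint G Λ β 0 .free x₃ x₄ -
        isingTwoPoint G Λ β 0 .free x₁ x₃ * isingTwoPoint G Λ β 0 .free x₂ x₄ -
        isingTwoPoint G Λ β 0 .free x₁ x₄ * isingTwoPoint G Λ β 0 .free x₂ x₃ := by
  -- real versions of the generating sums
  set zr : Finset V → ℝ := fun A => (currentZ G Λ β (edgesIn G Λ) A).toReal with hzr
  have hzfin : ∀ A : Finset V, currentZ G Λ β (edgesIn G Λ) A ≠ ∞ := fun A =>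
    currentZ_edgesIn_ne_top hβ subset_rfl A
  have hz0 : 0 < zr ∅ := toReal_currentZ_edgesIn_empty_pos hβ subset_rfl
  have hcorr : ∀ {A : Finset V}, A ⊆ Λ → isingCorr G Λ β 0 .free A = zr A / zr ∅ := fun hA =>
    isingCorr_free_eq_currentZ_div hβ subset_rfl hA
  have htp : ∀ {x y : V}, x ∈ Λ → y ∈ Λ → isingTwoPoint G Λ β 0 .free x y = zr ({x} ∆ {y}) / zr ∅ := by
    intro x y hx hy
    rw [agTwoPoint_eq_isingCorr, hcorr (singleton_symmDiff_singleton_subset hx hy)]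
  have htp' : ∀ {x y : V}, x ∈ Λ → y ∈ Λ → isingTwoPoint G Λ β 0 .free x y = zr ({y} ∆ {x}) / zr ∅ := by
    intro x y hx hy
    rw [agTwoPoint_eq_isingCorr', hcorr (singleton_symmDiff_singleton_subset hy hx)]
  have hsub4 : ∀ {a b c e : V}, a ∈ Λ → b ∈ Λ → c ∈ Λ → e ∈ Λ →
      ((({a} ∆ {b}) ∆ ({c} ∆ {e})) : Finset V) ⊆ Λ := fun ha hb hc he =>
    symmDiff_le_sup.trans (sup_le (singleton_symmDiff_singleton_subset ha hb)
      (singleton_symmDiff_singleton_subset hc he))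
  -- the pair sums and `R`, as real numbers
  set p₁ := (cpairSum G Λ β (edgesIn G Λ) (edgesIn G Λ) ({x₁} ∆ {x₃}) ({x₂} ∆ {x₄})
    (fun m => ind (CConn G Λ m (edgesIn G Λ) x₃ x₄))).toReal with hp₁
  set p₂ := (cpairSum G Λ β (edgesIn G Λ) (edgesIn G Λ) ({x₂} ∆ {x₃}) ({x₁} ∆ {x₄})
    (fun m => ind (CConn G Λ m (edgesIn G Λ) x₃ x₄))).toReal with hp₂
  set r : V → V → V → V → ℝ := fun a b u v => (agR G Λ β a b u v).toReal with hr
  have hPfin : ∀ (X Y : Finset V) (F : (edgesIn G Λ → ℕ) → Prop),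
      cpairSum G Λ β (edgesIn G Λ) (edgesIn G Λ) X Y (fun m => ind (F m)) ≠ ∞ := fun X Y F =>
    ne_top_of_le_ne_top (ENNReal.mul_ne_top (hzfin X) (hzfin Y)) (cpairSum_le_currentZ_mul fun m => ind_le_one _)
  -- (I) the Ursell identity
  have hI : zr (({x₁} ∆ {x₂}) ∆ ({x₃} ∆ {x₄})) * zr ∅ + p₁ + p₂ =
      zr ({x₁} ∆ {x₂}) * zr ({x₃} ∆ {x₄}) + zr ({x₁} ∆ {x₃}) * zr ({x₂} ∆ {x₄}) +
        zr ({x₂} ∆ {x₃}) * zr ({x₁} ∆ {x₄}) := by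
    have h := congrArg ENNReal.toReal (currentZ_ursell_identity G Λ hβ x₁ x₂ x₃ x₄)
    rw [ENNReal.toReal_add (ENNReal.add_ne_top.2 ⟨ENNReal.mul_ne_top (hzfin _) (hzfin _), hPfin _ _ _⟩) (hPfin _ _ _),
      ENNReal.toReal_add (ENNReal.mul_ne_top (hzfin _) (hzfin _)) (hPfin _ _ _),
      ENNReal.toReal_add (ENNReal.add_ne_top.2 ⟨ENNReal.mul_ne_top (hzfin _) (hzfin _),
        ENNReal.mul_ne_top (hzfin _) (hzfin _)⟩) (ENNReal.mul_ne_top (hzfin _) (hzfin _)),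
      ENNReal.toReal_add (ENNReal.mul_ne_top (hzfin _) (hzfin _)) (ENNReal.mul_ne_top (hzfin _) (hzfin _))] at h
    simpa only [ENNReal.toReal_mul] using h
  -- (III) `Z² ⟨σ_uσ_v;σ₃σ₄⟩ = R₃₄ + R₄₃`
  have hIII : ∀ {u v : V}, u ∈ Λ → v ∈ Λ →
      zr (({u} ∆ {v}) ∆ ({x₃} ∆ {x₄})) * zr ∅ = zr ({u} ∆ {v}) * zr ({x₃} ∆ {x₄}) + (r x₃ x₄ u v + r x₄ x₃ u v) := by
    intro u v hu hv
    have h := congrArg ENNReal.toReal (currentZ_four_mul_currentZ_empty_eq_agR (G := G) hβ hu hv hx₃ hx₄)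
    rw [ENNReal.toReal_add (ENNReal.mul_ne_top (hzfin _) (hzfin _))
        (ENNReal.add_ne_top.2 ⟨agR_ne_top hβ hu hv hx₃ hx₄, agR_ne_top hβ hu hv hx₄ hx₃⟩),
      ENNReal.toReal_add (agR_ne_top hβ hu hv hx₃ hx₄) (agR_ne_top hβ hu hv hx₄ hx₃)] at h
    simpa only [ENNReal.toReal_mul] using h
  -- (II) step 3 for `p₁` and (II') for `p₂`
  have htanh : 0 ≤ Real.tanh β := tanh_nonneg hβ
  have hsumfin : ∀ a b : V, a ∈ Λ → b ∈ Λ → ∀ u ∈ Λ, ∑ v ∈ Λ.filter (G.Adj u),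
      currentZ G Λ β (edgesIn G Λ) ({v} ∆ {x₁}) * currentZ G Λ β (edgesIn G Λ) ({x₂} ∆ {v}) *
        agR G Λ β a b u v ≠ ∞ := by
    intro a b ha hb u hu
    exact ENNReal.sum_ne_top.2 fun v hv => ENNReal.mul_ne_top (ENNReal.mul_ne_top (hzfin _) (hzfin _))
      (agR_ne_top hβ hu (mem_filter.1 hv).1 ha hb)
  have htoReal_sum : ∀ a b : V, a ∈ Λ → b ∈ Λ →
      (ENNReal.ofReal (Real.tanh β) * ∑ u ∈ Λ, ∑ v ∈ Λ.filter (G.Adj u),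
        currentZ G Λ β (edgesIn G Λ) ({v} ∆ {x₁}) * currentZ G Λ β (edgesIn G Λ) ({x₂} ∆ {v}) *
          agR G Λ β a b u v).toReal =
      Real.tanh β * ∑ u ∈ Λ, ∑ v ∈ Λ.filter (G.Adj u), zr ({v} ∆ {x₁}) * zr ({x₂} ∆ {v}) * r a b u v := by
    intro a b ha hb
    rw [ENNReal.toReal_mul, ENNReal.toReal_ofReal htanh, ENNReal.toReal_sum (hsumfin a b ha hb)]
    congr 1
    refine sum_congr rfl fun u hu => ?_
    rw [ENNReal.toReal_sum fun v hv => ENNReal.mul_ne_top (ENNReal.mul_ne_top (hzfin _) (hzfin _))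
      (agR_ne_top hβ hu (mem_filter.1 hv).1 ha hb)]
    refine sum_congr rfl fun v _ => ?_
    rw [ENNReal.toReal_mul, ENNReal.toReal_mul]
  have hII : zr ∅ * zr ∅ * p₁ ≤
      Real.tanh β * (∑ u ∈ Λ, ∑ v ∈ Λ.filter (G.Adj u), zr ({v} ∆ {x₁}) * zr ({x₂} ∆ {v}) * r x₃ x₄ u v) +
        zr ∅ * (zr ({x₁} ∆ {x₃}) * (zr ({x₄} ∆ {x₃}) * zr ({x₂} ∆ {x₃}))) := by
    have h := cpairSum_pair_pair_conn_le G Λ hβ (x₁ := x₁) hx₂ hx₃ hx₄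
    have hfin : ENNReal.ofReal (Real.tanh β) * (∑ u ∈ Λ, ∑ v ∈ Λ.filter (G.Adj u),
        currentZ G Λ β (edgesIn G Λ) ({v} ∆ {x₁}) * currentZ G Λ β (edgesIn G Λ) ({x₂} ∆ {v}) *
          agR G Λ β x₃ x₄ u v) +
        currentZ G Λ β (edgesIn G Λ) ∅ * (currentZ G Λ β (edgesIn G Λ) ({x₁} ∆ {x₃}) *
          (currentZ G Λ β (edgesIn G Λ) ({x₄} ∆ {x₃}) * currentZ G Λ β (edgesIn G Λ) ({x₂} ∆ {x₃}))) ≠ ∞ :=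
      ENNReal.add_ne_top.2 ⟨ENNReal.mul_ne_top ENNReal.ofReal_ne_top (ENNReal.sum_ne_top.2 (hsumfin x₃ x₄ hx₃ hx₄)),
        ENNReal.mul_ne_top (hzfin _) (ENNReal.mul_ne_top (hzfin _) (ENNReal.mul_ne_top (hzfin _) (hzfin _)))⟩
    have h' := ENNReal.toReal_mono hfin h
    rw [ENNReal.toReal_mul, ENNReal.toReal_mul, ENNReal.toReal_add (ENNReal.add_ne_top.1 hfin).1
      (ENNReal.add_ne_top.1 hfin).2, htoReal_sum x₃ x₄ hx₃ hx₄] at h'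
    simpa only [ENNReal.toReal_mul] using h'
  have hII' : zr ∅ * zr ∅ * p₂ ≤
      Real.tanh β * (∑ u ∈ Λ, ∑ v ∈ Λ.filter (G.Adj u), zr ({v} ∆ {x₁}) * zr ({x₂} ∆ {v}) * r x₄ x₃ u v) +
        zr ∅ * (zr ({x₁} ∆ {x₄}) * (zr ({x₃} ∆ {x₄}) * zr ({x₂} ∆ {x₄}))) := by
    have h := cpairSum_pair_pair_conn_le G Λ hβ (x₁ := x₁) hx₂ hx₄ hx₃
    -- `p₂` is the left-hand side with `x₃ ↔ x₄` exchanged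
    have hp₂' : cpairSum G Λ β (edgesIn G Λ) (edgesIn G Λ) ({x₂} ∆ {x₃}) ({x₁} ∆ {x₄})
        (fun m => ind (CConn G Λ m (edgesIn G Λ) x₃ x₄)) =
        cpairSum G Λ β (edgesIn G Λ) (edgesIn G Λ) ({x₁} ∆ {x₄}) ({x₂} ∆ {x₃})
          (fun m => ind (CConn G Λ m (edgesIn G Λ) x₄ x₃)) := by
      rw [cpairSum_comm]
      exact cpairSum_congr fun n₁ n₂ _ _ _ _ => ind_cconn_comm _ _ _ _
    have hfin : ENNReal.ofReal (Real.tanh β) * (∑ u ∈ Λ, ∑ v ∈ Λ.filter (G.Adj u),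
        currentZ G Λ β (edgesIn G Λ) ({v} ∆ {x₁}) * currentZ G Λ β (edgesIn G Λ) ({x₂} ∆ {v}) *
          agR G Λ β x₄ x₃ u v) +
        currentZ G Λ β (edgesIn G Λ) ∅ * (currentZ G Λ β (edgesIn G Λ) ({x₁} ∆ {x₄}) *
          (currentZ G Λ β (edgesIn G Λ) ({x₃} ∆ {x₄}) * currentZ G Λ β (edgesIn G Λ) ({x₂} ∆ {x₄}))) ≠ ∞ :=
      ENNReal.add_ne_top.2 ⟨ENNReal.mul_ne_top ENNReal.ofReal_ne_top (ENNReal.sum_ne_top.2 (hsumfin x₄ x₃ hx₄ hx₃)),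
        ENNReal.mul_ne_top (hzfin _) (ENNReal.mul_ne_top (hzfin _) (ENNReal.mul_ne_top (hzfin _) (hzfin _)))⟩
    have h' := ENNReal.toReal_mono hfin h
    rw [← hp₂', ENNReal.toReal_mul, ENNReal.toReal_mul, ENNReal.toReal_add (ENNReal.add_ne_top.1 hfin).1
      (ENNReal.add_ne_top.1 hfin).2, htoReal_sum x₄ x₃ hx₄ hx₃] at h'
    simpa only [ENNReal.toReal_mul] using h'
  -- the sum of the two `R`-terms is `Z² ∑ ⟨σ₁σ_v⟩⟨σ₂σ_v⟩ ⟨σ_uσ_v;σ₃σ₄⟩`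
  have hRsum : (∑ u ∈ Λ, ∑ v ∈ Λ.filter (G.Adj u), zr ({v} ∆ {x₁}) * zr ({x₂} ∆ {v}) * r x₃ x₄ u v) +
      (∑ u ∈ Λ, ∑ v ∈ Λ.filter (G.Adj u), zr ({v} ∆ {x₁}) * zr ({x₂} ∆ {v}) * r x₄ x₃ u v) =
      ∑ u ∈ Λ, ∑ v ∈ Λ.filter (G.Adj u), zr ({v} ∆ {x₁}) * zr ({x₂} ∆ {v}) *
        (zr (({u} ∆ {v}) ∆ ({x₃} ∆ {x₄})) * zr ∅ - zr ({u} ∆ {v}) * zr ({x₃} ∆ {x₄})) := by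
    rw [← sum_add_distrib]
    refine sum_congr rfl fun u hu => ?_
    rw [← sum_add_distrib]
    refine sum_congr rfl fun v hv => ?_
    rw [hIII hu (mem_filter.1 hv).1]
    ring
  -- conversion of the statement to the `zr`
  have hU : isingCorr G Λ β 0 .free (({x₁} ∆ {x₂}) ∆ ({x₃} ∆ {x₄})) -
        isingTwoPoint G Λ β 0 .free x₁ x₂ * isingTwoPoint G Λ β 0 .free x₃ x₄ -
        isingTwoPoint G Λ β 0 .free x₁ x₃ * isingTwoPoint G Λ β 0 .free x₂ x₄ -
        isingTwoPoint G Λ β 0 .free x₁ x₄ * isingTwoPoint G Λ β 0 .free x₂ x₃ =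
      -(p₁ + p₂) / (zr ∅ * zr ∅) := by
    rw [hcorr (hsub4 hx₁ hx₂ hx₃ hx₄), htp hx₁ hx₂, htp hx₃ hx₄, htp hx₁ hx₃, htp hx₂ hx₄, htp hx₁ hx₄,
      htp hx₂ hx₃]
    field_simp
    linarith [hI]
  have hS : ∑ u ∈ Λ, ∑ v ∈ Λ.filter (G.Adj u),
        isingTwoPoint G Λ β 0 .free x₁ v * isingTwoPoint G Λ β 0 .free x₂ v *
          (isingCorr G Λ β 0 .free (({u} ∆ {v}) ∆ ({x₃} ∆ {x₄})) -
            isingTwoPoint G Λ β 0 .free u v * isingTwoPoint G Λ β 0 .free x₃ x₄) =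
      (∑ u ∈ Λ, ∑ v ∈ Λ.filter (G.Adj u), zr ({v} ∆ {x₁}) * zr ({x₂} ∆ {v}) *
        (zr (({u} ∆ {v}) ∆ ({x₃} ∆ {x₄})) * zr ∅ - zr ({u} ∆ {v}) * zr ({x₃} ∆ {x₄}))) /
        (zr ∅ * zr ∅ * zr ∅ * zr ∅) := by
    rw [sum_div]
    refine sum_congr rfl fun u hu => ?_
    rw [sum_div]
    refine sum_congr rfl fun v hv => ?_
    have hvΛ : v ∈ Λ := (mem_filter.1 hv).1
    rw [htp' hx₁ hvΛ, htp hx₂ hvΛ, hcorr (hsub4 hu hvΛ hx₃ hx₄), htp hu hvΛ, htp hx₃ hx₄]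
    field_simp
  have hG3 : isingTwoPoint G Λ β 0 .free x₁ x₃ * isingTwoPoint G Λ β 0 .free x₂ x₃ *
          isingTwoPoint G Λ β 0 .free x₄ x₃ +
        isingTwoPoint G Λ β 0 .free x₁ x₄ * isingTwoPoint G Λ β 0 .free x₂ x₄ *
          isingTwoPoint G Λ β 0 .free x₃ x₄ =
      (zr ({x₁} ∆ {x₃}) * (zr ({x₄} ∆ {x₃}) * zr ({x₂} ∆ {x₃})) +
        zr ({x₁} ∆ {x₄}) * (zr ({x₃} ∆ {x₄}) * zr ({x₂} ∆ {x₄}))) / (zr ∅ * zr ∅ * zr ∅) := by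
    rw [htp hx₁ hx₃, htp hx₂ hx₃, htp hx₄ hx₃, htp hx₁ hx₄, htp hx₂ hx₄, htp hx₃ hx₄]
    field_simp
  -- assemble
  have hkey : zr ∅ * zr ∅ * (p₁ + p₂) ≤
      Real.tanh β * ∑ u ∈ Λ, ∑ v ∈ Λ.filter (G.Adj u), zr ({v} ∆ {x₁}) * zr ({x₂} ∆ {v}) *
          (zr (({u} ∆ {v}) ∆ ({x₃} ∆ {x₄})) * zr ∅ - zr ({u} ∆ {v}) * zr ({x₃} ∆ {x₄})) +
        zr ∅ * (zr ({x₁} ∆ {x₃}) * (zr ({x₄} ∆ {x₃}) * zr ({x₂} ∆ {x₃})) +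
          zr ({x₁} ∆ {x₄}) * (zr ({x₃} ∆ {x₄}) * zr ({x₂} ∆ {x₄}))) := by
    rw [← hRsum]
    nlinarith [hII, hII']
  have hz2 : 0 < zr ∅ * zr ∅ := mul_pos hz0 hz0
  have hz3 : 0 < zr ∅ * zr ∅ * zr ∅ := mul_pos hz2 hz0
  have hz4 : 0 < zr ∅ * zr ∅ * zr ∅ * zr ∅ := mul_pos hz3 hz0
  rw [hU, hS, sub_sub, hG3, neg_div, le_neg, neg_sub', neg_neg, sub_neg_eq_add, ← mul_div_assoc,
    div_add_div _ _ hz4.ne' hz3.ne', div_le_div_iff₀ hz2 (mul_pos hz4 hz3)]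
  have h5 : 0 ≤ zr ∅ * zr ∅ * zr ∅ * zr ∅ * zr ∅ := by positivity
  nlinarith [mul_le_mul_of_nonneg_left hkey h5]

/-! ### Discharge of the named fact `aizenmanGraham_inequality` -/

/-- The four-point function of `AizenmanGrahamInequality.lean` is the correlation of the symmetric
difference: `⟨(σ_{x₁}σ_{x₂})(σ_{x₃}σ_{x₄})⟩ = ⟨σ_{({x₁}∆{x₂})∆({x₃}∆{x₄})}⟩` (`σ_x² = 1`). [folklore] -/
theorem isingFourPoint_eq_isingCorr_symmDiff (Λ' : Finset V) (β h : ℝ) (bc : BoundaryCondition V)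
    (x₁ x₂ x₃ x₄ : V) :
    isingFourPoint G Λ' β h bc x₁ x₂ x₃ x₄ = isingCorr G Λ' β h bc (({x₁} ∆ {x₂}) ∆ ({x₃} ∆ {x₄})) := by
  unfold isingFourPoint isingCorr
  congr 1
  funext σ
  rw [spinPair_eq_spinProduct_symmDiff x₁ x₂, spinPair_eq_spinProduct_symmDiff x₃ x₄, spinProduct_mul_spinProduct]

variable (G) in
/-- **Discharge of the named fact `aizenmanGraham_inequality`** (Tasaki–Hara 2015, Theorem A.18,
eq. (A.125); Aizenman–Graham 1983): the finite-volume Aizenman–Graham inequality holds for the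
tree's nearest-neighbour Ising model on every finite volume `Λ` of every locally finite graph
`G`, free boundary condition, zero field, `β ≥ 0` — by the random-current proof of this file
(`aizenmanGraham_inequality_isingCorr`). [cite: TasakiHara2015, Appendix A, Theorem A.18, eq. (A.125)] -/
theorem aizenmanGraham_inequality_holds [DecidableRel G.Adj] (Λ' : Finset V) (β : ℝ) :
    aizenmanGraham_inequality G Λ' β := by
  intro hβ x₁ x₂ x₃ x₄ hx₁ hx₂ hx₃ hx₄
  have h := aizenmanGraham_inequality_isingCorr G Λ' hβ hx₁ hx₂ hx₃ hx₄
  simp only [isingPairCov, isingUrsellFour, isingFourPoint_eq_isingCorr_symmDiff] at h ⊢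
  exact h

end AG

end Literature.Probability.LatticeModels
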